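import Literature.NumberTheory.LFunctions.ConreyIwaniec2002AFEDefs
import Literature.NumberTheory.LFunctions.ConreyIwaniec2002AFELineIntegrals
import Literature.NumberTheory.LFunctions.ConreyIwaniec2002GammaShiftRatio
import Mathlib.Analysis.SpecialFunctions.Gaussian.GaussianIntegral
import Mathlib.Analysis.Complex.Liouville
import HarnessLib

/-!
# Conrey–Iwaniec (2002), Lemmas 7.2 and 7.4: bounds for the kernel `V_s(y)` of the approximate
# functional equation (test function `G(u) = e^{u²}`)

B. Conrey, H. Iwaniec, *Spacing of zeros of Hecke L-functions and the class number problem*,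
Acta Arith. 103 (2002), §7, Lemma 7.2 (7.16)–(7.17) and Lemma 7.4 (7.25) [held text
`paper:arxiv-math_0111012`, p0017–p0018]. Everything here is PROVED; no definitions, no named
facts. This is stub **S2** (`stub_afeV_bounds`) of the fact skeleton `prop81-afe-plancherel`
(Proposition 8.1 line, cell landau-siegel / ls-inputs), for the typed kernel
`ConreyIwaniec2002.afeV` of `ConreyIwaniec2002AFEDefs.lean`:

  `V_s(y) = (1/2π) ∫ Γ(s+u)/Γ(s) · e^{u²} y^{−u} u^{−1} dv`,  `u = 1 + iv`.

## Main statement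

* `ConreyIwaniec2002.afeV_bounds` — ONE absolute `C` such that, for `3/8 ≤ Re w ≤ 5/8`,
  `|Im w| ≥ 1`, `y > 0`: `‖V(w,y)‖ ≤ C(1+y/‖w‖)^{−6}`, `‖V(w,y) − 1‖ ≤ C(y/‖w‖)^{1/4}`, `V(w,·)` is
  differentiable at `y`, `‖y∂_yV(w,y)‖ ≤ C min((1+y/‖w‖)^{−6}, (y/‖w‖)^{1/4})`; and for
  `s = ½+it`, `s′ = ½+it′`, `|t| ≥ 2`, `0 < |t−t′| ≤ 1`: the divided differences
  `(V(s,y) − V(s′,y))/(s−s′)` and `y(∂_yV(s,y) − ∂_yV(s′,y))/(s−s′)` are `≤ C(1+y/‖s‖)^{−6}`.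

(The paper's Lemma 7.2 is stated for `G(u) = cos(πu/A)^{−A}` and any `A`; the line uses the entire
Gaussian-type `G(u) = e^{u²}` and `A = 6`, and only close companions `|s − s′| ≤ 1` in Lemma 7.4 —
see the skeleton's docstring for why (7.25) is restricted to close companions.)

## Proof (the paper's, made quantitative)

With `h_w(u) = Γ(w+u)/Γ(w)` and `F_k(u) = h_w(u)e^{u²}y^{−u}u^{−k}`:
* Stirling (`AFEKernel.exists_norm_Gamma_add_div_le`, file `ConreyIwaniec2002GammaShiftRatio`):
  `‖h_w(c+iv)‖ ≤ C‖w‖^c(1+|v|)^7e^{π|v|/2}` for `−1/4 ≤ c ≤ 6` — the "Stirling class" hypothesis of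
  the line-integral machinery `ConreyIwaniec2002AFELineIntegrals` (Gaussian majorant, shifts);
* (a) shift `Re u = 1 → 6` (no pole): `‖V‖ ≪ (‖w‖/y)^6`; (b) shift `Re u = 1 → −1/4` across the
  simple pole at `u = 0` with residue `h_w(0) = 1`: `‖V − 1‖ ≪ (y/‖w‖)^{1/4}`; together
  `‖V‖ ≪ (1+y/‖w‖)^{−6}` (`afeV_strip_bounds`);
* (c) `∂_y` under the integral sign (`hasDerivAt_afeV`, dominated by the Gaussian majorant on
  `y′ ∈ (y/2, 2y)`): `y∂_yV = −(1/2π)∫F₀(1+iv)dv`, the pole being removed; shifts of `F₀` to `6`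
  and `−1/4`;
* (d) for fixed `u`, `w ↦ Γ(w+u)/Γ(w)` is holomorphic on `Re w > 1/4`; Cauchy's estimate on circles
  of radius `1/8` around the segment `[s′,s]` (where `3/8 ≤ Re ≤ 5/8`, `|Im| ≥ 7/8`, `‖·‖ ≍ ‖s‖`)
  and the mean value inequality make the divided difference `H_{s,s′}(u)` of Stirling class with
  scale `‖s‖` and constant `120C` (`dd_gammaRatio_line_bound`); `H_{s,s′}(0) = 0`, so the shift to
  `Re u = −1/4` has no residue (`dd_afeV_bounds`).

Mathlib: `hasDerivAt_integral_of_dominated_loc_of_deriv_le`, `hasDerivAt_ofReal_cpow_const`,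
`Complex.norm_deriv_le_of_forall_mem_sphere_norm_le`, `Convex.norm_image_sub_le_of_norm_deriv_le`,
`Complex.differentiableAt_Gamma`. Tree: `ConreyIwaniec2002AFELineIntegrals`,
`ConreyIwaniec2002GammaShiftRatio`, `ConreyIwaniec2002AFEDefs` (`afeV`, `afeG`).

«The programme SEARCHES and TYPES; no claim about Landau–Siegel zeros until a kernel theorem says so.»
-/

noncomputable section

open Complex MeasureTheory Real Set Filter
open scoped Topology

namespace Literature.NumberTheory.LFunctions

namespace ConreyIwaniec2002


namespace AFEKernel

/-! ## The numerator `h_w(u) = Γ(w+u)/Γ(w)`: holomorphy and Stirling class -/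

/-- `u ↦ Γ(w+u)/Γ(w)` is holomorphic on `Re u ≥ −1/4` when `Re w ≥ 3/8` (no poles of `Γ(w+u)`:
`Re(w+u) > 0`). [cite: ConreyIwaniec2002, Proposition 7.1 (proof, the integrand of (7.14))] -/
theorem differentiableAt_gammaRatio {w u : ℂ} (hw : 3 / 8 ≤ w.re) (hu : -1 / 4 ≤ u.re) :
    DifferentiableAt ℂ (fun u : ℂ ↦ Complex.Gamma (w + u) / Complex.Gamma w) u := by
  have hne : ∀ m : ℕ, w + u ≠ -(m : ℂ) := by
    intro m h
    have := congrArg Complex.re h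
    simp at this
    linarith
  have h1 : DifferentiableAt ℂ (fun u : ℂ ↦ Complex.Gamma (w + u)) u :=
    (Complex.differentiableAt_Gamma _ hne).comp u ((differentiableAt_id).const_add w)
  exact h1.div_const _

/-- Differentiability of `h_w` on the closed strips `a ≤ Re u ≤ b`, `a ≥ −1/4`.
[cite: ConreyIwaniec2002, Proposition 7.1 (proof, the integrand of (7.14))] -/
theorem differentiableOn_gammaRatio {w : ℂ} (hw : 3 / 8 ≤ w.re) {a b : ℝ} (ha : -1 / 4 ≤ a) :
    DifferentiableOn ℂ (fun u : ℂ ↦ Complex.Gamma (w + u) / Complex.Gamma w) (re ⁻¹' Icc a b) := by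
  intro u hu
  have hu' : a ≤ u.re := by simpa using (show u.re ∈ Icc a b from hu).1
  exact (differentiableAt_gammaRatio hw (by linarith)).differentiableWithinAt

/-- Continuity of `h_w` along a vertical line `Re u = c ≥ −1/4`.
[cite: ConreyIwaniec2002, Proposition 7.1 (proof, the integrand of (7.14))] -/
theorem continuous_gammaRatio_line {w : ℂ} (hw : 3 / 8 ≤ w.re) {c : ℝ} (hc : -1 / 4 ≤ c) :
    Continuous fun v : ℝ ↦
      (fun u : ℂ ↦ Complex.Gamma (w + u) / Complex.Gamma w) ((c : ℂ) + v * I) := by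
  have hl : Continuous fun v : ℝ ↦ (c : ℂ) + v * I := by fun_prop
  have hg : ∀ v : ℝ, ContinuousAt (fun u : ℂ ↦ Complex.Gamma (w + u) / Complex.Gamma w)
      ((c : ℂ) + v * I) := fun v ↦
    (differentiableAt_gammaRatio hw (u := (c : ℂ) + v * I) (by simp [hc])).continuousAt
  have e : (fun v : ℝ ↦ (fun u : ℂ ↦ Complex.Gamma (w + u) / Complex.Gamma w) ((c : ℂ) + v * I)) =
      (fun u : ℂ ↦ Complex.Gamma (w + u) / Complex.Gamma w) ∘ (fun v : ℝ ↦ (c : ℂ) + v * I) := rfl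
  rw [e]
  exact continuous_iff_continuousAt.2 fun v ↦ (hg v).comp_of_eq hl.continuousAt rfl

/-- **Stirling class of `h_w` on a line**: for `3/8 ≤ Re w ≤ 5/8`, `|Im w| ≥ 1/2` and
`−1/4 ≤ c ≤ 6`, `‖Γ(w+c+iv)/Γ(w)‖ ≤ (C‖w‖^c)(1+|v|)^7 e^{π|v|/2}` with the absolute `C` of
`exists_norm_Gamma_add_div_le`. [cite: ConreyIwaniec2002, Lemma 7.2 (proof, Stirling)] -/
theorem gammaRatio_line_bound {C : ℝ}
    (hb : ∀ (w u : ℂ), 3 / 8 ≤ w.re → w.re ≤ 5 / 8 → 1 / 2 ≤ |w.im| → -1 / 4 ≤ u.re → u.re ≤ 6 →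
      ‖Complex.Gamma (w + u) / Complex.Gamma w‖ ≤
        C * ‖w‖ ^ u.re * (1 + |u.im|) ^ 7 * Real.exp (π * |u.im| / 2))
    {w : ℂ} (hw1 : 3 / 8 ≤ w.re) (hw2 : w.re ≤ 5 / 8) (hwi : 1 / 2 ≤ |w.im|) {c : ℝ}
    (hc1 : -1 / 4 ≤ c) (hc2 : c ≤ 6) (v : ℝ) :
    ‖(fun u : ℂ ↦ Complex.Gamma (w + u) / Complex.Gamma w) ((c : ℂ) + v * I)‖ ≤
      C * ‖w‖ ^ c * (1 + |v|) ^ 7 * Real.exp (π * |v| / 2) := by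
  have := hb w ((c : ℂ) + v * I) hw1 hw2 hwi (by simp [hc1]) (by simp [hc2])
  simpa using this

/-- **Stirling class of `h_w` on a strip** `a ≤ Re u ≤ b` (`−1/4 ≤ a ≤ b ≤ 6`), with the uniform
constant `C(‖w‖^a + ‖w‖^b)`. [cite: ConreyIwaniec2002, Lemma 7.2 (proof, Stirling)] -/
theorem gammaRatio_strip_bound {C : ℝ} (hC : 0 ≤ C)
    (hb : ∀ (w u : ℂ), 3 / 8 ≤ w.re → w.re ≤ 5 / 8 → 1 / 2 ≤ |w.im| → -1 / 4 ≤ u.re → u.re ≤ 6 →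
      ‖Complex.Gamma (w + u) / Complex.Gamma w‖ ≤
        C * ‖w‖ ^ u.re * (1 + |u.im|) ^ 7 * Real.exp (π * |u.im| / 2))
    {w : ℂ} (hw1 : 3 / 8 ≤ w.re) (hw2 : w.re ≤ 5 / 8) (hwi : 1 / 2 ≤ |w.im|) {a b : ℝ}
    (ha : -1 / 4 ≤ a) (hb6 : b ≤ 6) :
    ∀ u : ℂ, a ≤ u.re → u.re ≤ b →
      ‖(fun u : ℂ ↦ Complex.Gamma (w + u) / Complex.Gamma w) u‖ ≤
        C * (‖w‖ ^ a + ‖w‖ ^ b) * (1 + |u.im|) ^ 7 * Real.exp (π * |u.im| / 2) := by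
  intro u hua hub
  have h := hb w u hw1 hw2 hwi (by linarith) (by linarith)
  have hw0 : 0 < ‖w‖ := by
    have := Complex.abs_im_le_norm w
    linarith
  have hpow : ‖w‖ ^ u.re ≤ ‖w‖ ^ a + ‖w‖ ^ b := by
    have ha0 : 0 ≤ ‖w‖ ^ a := Real.rpow_nonneg hw0.le a
    have hb0 : 0 ≤ ‖w‖ ^ b := Real.rpow_nonneg hw0.le b
    rcases le_or_gt 1 ‖w‖ with h1 | h1
    · have : ‖w‖ ^ u.re ≤ ‖w‖ ^ b := Real.rpow_le_rpow_of_exponent_le h1 hub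
      linarith
    · have : ‖w‖ ^ u.re ≤ ‖w‖ ^ a := Real.rpow_le_rpow_of_exponent_ge hw0 h1.le hua
      linarith
  refine h.trans ?_
  have : 0 ≤ (1 + |u.im|) ^ 7 * Real.exp (π * |u.im| / 2) := by positivity
  calc C * ‖w‖ ^ u.re * (1 + |u.im|) ^ 7 * Real.exp (π * |u.im| / 2)
      = C * ‖w‖ ^ u.re * ((1 + |u.im|) ^ 7 * Real.exp (π * |u.im| / 2)) := by ring
    _ ≤ C * (‖w‖ ^ a + ‖w‖ ^ b) * ((1 + |u.im|) ^ 7 * Real.exp (π * |u.im| / 2)) := by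
        gcongr
    _ = _ := by ring

/-! ## `V` as a Gaussian line integral; the two contour shifts -/

/-- `V(w,y) = (1/2π) ∫ F₁(1+iv) dv` with `F₁(u) = h_w(u) e^{u²} y^{−u}/u` — the definition (7.14)
in the shape of `ConreyIwaniec2002AFELineIntegrals`. [cite: ConreyIwaniec2002, Proposition 7.1 (7.14)] -/
theorem afeV_eq_lineF (w : ℂ) (y : ℝ) :
    afeV w y = (1 / (2 * Real.pi) : ℂ) * ∫ v : ℝ,
      (fun u : ℂ ↦ Complex.Gamma (w + u) / Complex.Gamma w) (((1 : ℝ) : ℂ) + v * I) *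
        cexp ((((1 : ℝ) : ℂ) + v * I) ^ 2) * (y : ℂ) ^ (-(((1 : ℝ) : ℂ) + v * I)) /
          (((1 : ℝ) : ℂ) + v * I) ^ 1 := by
  simp only [afeV, afeG, Complex.ofReal_one, pow_one]

/-- `h_w(0) = 1`. [cite: ConreyIwaniec2002, Lemma 7.2 (proof, residue 1 at u = 0)] -/
theorem gammaRatio_zero {w : ℂ} (hw : 3 / 8 ≤ w.re) :
    (fun u : ℂ ↦ Complex.Gamma (w + u) / Complex.Gamma w) 0 = 1 := by
  have hne : Complex.Gamma w ≠ 0 := Complex.Gamma_ne_zero_of_re_pos (by linarith)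
  simp [hne]

/-- The half-Gaussian is integrable. [folklore] -/
private theorem integrable_exp_neg_sq_half' : Integrable fun v : ℝ ↦ Real.exp (-(v ^ 2 / 2)) := by
  have h := integrable_exp_neg_mul_sq (b := 1 / 2) (by norm_num)
  refine h.congr (Filter.Eventually.of_forall fun v ↦ ?_)
  simp only
  congr 1
  ring

/-- **Shift to `Re u = 6`**: `V(w,y) = (1/2π)∫ F₁(6+iv) dv`.
[cite: ConreyIwaniec2002, Lemma 7.2 (proof, moving the integration to the line Re u = A)] -/
theorem afeV_eq_line_six {C : ℝ} (hC : 0 ≤ C)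
    (hb : ∀ (w u : ℂ), 3 / 8 ≤ w.re → w.re ≤ 5 / 8 → 1 / 2 ≤ |w.im| → -1 / 4 ≤ u.re → u.re ≤ 6 →
      ‖Complex.Gamma (w + u) / Complex.Gamma w‖ ≤
        C * ‖w‖ ^ u.re * (1 + |u.im|) ^ 7 * Real.exp (π * |u.im| / 2))
    {w : ℂ} (hw1 : 3 / 8 ≤ w.re) (hw2 : w.re ≤ 5 / 8) (hwi : 1 / 2 ≤ |w.im|) {y : ℝ} (hy : 0 < y) :
    afeV w y = (1 / (2 * Real.pi) : ℂ) * ∫ v : ℝ,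
      (fun u : ℂ ↦ Complex.Gamma (w + u) / Complex.Gamma w) (((6 : ℝ) : ℂ) + v * I) *
        cexp ((((6 : ℝ) : ℂ) + v * I) ^ 2) * (y : ℂ) ^ (-(((6 : ℝ) : ℂ) + v * I)) /
          (((6 : ℝ) : ℂ) + v * I) ^ 1 := by
  rw [afeV_eq_lineF]
  congr 1
  exact integral_lineF_eq_of_noPole (h := fun u : ℂ ↦ Complex.Gamma (w + u) / Complex.Gamma w)
    (a := 1) (b := 6) (k := 1) (n := 7) (by norm_num) hy
    (Or.inr (Or.inr one_pos)) (differentiableOn_gammaRatio hw1 (by norm_num))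
    (gammaRatio_strip_bound hC hb hw1 hw2 hwi (by norm_num) le_rfl)

/-- **Shift to `Re u = −1/4` across the pole at `u = 0`** (residue `h_w(0) = 1`):
`V(w,y) − 1 = (1/2π)∫ F₁(−1/4+iv) dv`.
[cite: ConreyIwaniec2002, Lemma 7.2 (proof, the simple pole at u = 0 with residue 1)] -/
theorem afeV_sub_one_eq_line {C : ℝ} (hC : 0 ≤ C)
    (hb : ∀ (w u : ℂ), 3 / 8 ≤ w.re → w.re ≤ 5 / 8 → 1 / 2 ≤ |w.im| → -1 / 4 ≤ u.re → u.re ≤ 6 →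
      ‖Complex.Gamma (w + u) / Complex.Gamma w‖ ≤
        C * ‖w‖ ^ u.re * (1 + |u.im|) ^ 7 * Real.exp (π * |u.im| / 2))
    {w : ℂ} (hw1 : 3 / 8 ≤ w.re) (hw2 : w.re ≤ 5 / 8) (hwi : 1 / 2 ≤ |w.im|) {y : ℝ} (hy : 0 < y) :
    afeV w y - 1 = (1 / (2 * Real.pi) : ℂ) * ∫ v : ℝ,
      (fun u : ℂ ↦ Complex.Gamma (w + u) / Complex.Gamma w) (((-1 / 4 : ℝ) : ℂ) + v * I) *
        cexp ((((-1 / 4 : ℝ) : ℂ) + v * I) ^ 2) * (y : ℂ) ^ (-(((-1 / 4 : ℝ) : ℂ) + v * I)) /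
          (((-1 / 4 : ℝ) : ℂ) + v * I) := by
  have key := integral_lineF_one_sub_eq
    (h := fun u : ℂ ↦ Complex.Gamma (w + u) / Complex.Gamma w) (a := -1 / 4) (b := 1) (n := 7)
    (by norm_num) one_pos hy (differentiableOn_gammaRatio hw1 le_rfl)
    (gammaRatio_strip_bound hC hb hw1 hw2 hwi le_rfl (by norm_num))
  have h0 : (fun u : ℂ ↦ Complex.Gamma (w + u) / Complex.Gamma w) 0 = 1 := gammaRatio_zero hw1
  simp only [add_zero] at h0
  simp only [add_zero, h0, mul_one] at key
  rw [afeV_eq_lineF]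
  simp only [pow_one]
  have hπ : (Real.pi : ℂ) ≠ 0 := by exact_mod_cast Real.pi_pos.ne'
  have hc : (1 / (2 * Real.pi) : ℂ) * (2 * Real.pi) = 1 := by field_simp
  linear_combination (1 / (2 * Real.pi) : ℂ) * key + hc

/-! ## Real-variable packaging lemmas -/

/-- `A^6 y^{-6} = (A/y)^6` in `rpow` form. [folklore] -/
private theorem rpow_six_mul_rpow_neg_six {A y : ℝ} (hy : 0 < y) :
    A ^ (6 : ℝ) * y ^ (-(6 : ℝ)) = (A / y) ^ 6 := by
  rw [Real.rpow_neg hy.le, show (6 : ℝ) = ((6 : ℕ) : ℝ) by norm_num, Real.rpow_natCast,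
    Real.rpow_natCast, div_pow, div_eq_mul_inv]

/-- `A^{-1/4} y^{1/4} = (y/A)^{1/4}`. [folklore] -/
private theorem rpow_neg_quarter_mul {A y : ℝ} (hA : 0 < A) (hy : 0 ≤ y) :
    A ^ (-(1 / 4 : ℝ)) * y ^ (1 / 4 : ℝ) = (y / A) ^ (1 / 4 : ℝ) := by
  rw [Real.div_rpow hy hA.le, Real.rpow_neg hA.le, mul_comm, ← div_eq_mul_inv]

/-- Packaging two scale bounds into `(1 + y/A)^{-6}`: if `X ≤ K₁` for `y ≤ A` and
`X ≤ K₂ (A/y)^6` for `y > A`, then `X ≤ 64(K₁+K₂)(1+y/A)^{-6}`. [folklore] -/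
private theorem le_inv_one_add_pow_six {X A y K₁ K₂ : ℝ} (hA : 0 < A) (hy : 0 < y) (hK₁ : 0 ≤ K₁)
    (hK₂ : 0 ≤ K₂) (h1 : y ≤ A → X ≤ K₁) (h2 : A < y → X ≤ K₂ * (A / y) ^ 6) :
    X ≤ 64 * (K₁ + K₂) * ((1 + y / A) ^ 6)⁻¹ := by
  have hq : 0 < 1 + y / A := by positivity
  have hq6 : 0 < (1 + y / A) ^ 6 := pow_pos hq 6
  rw [← div_eq_mul_inv, le_div_iff₀ hq6]
  rcases le_or_gt y A with hyA | hyA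
  · have hX := h1 hyA
    have hr : y / A ≤ 1 := (div_le_one hA).2 hyA
    have h64 : (1 + y / A) ^ 6 ≤ 64 := by
      calc (1 + y / A) ^ 6 ≤ (2 : ℝ) ^ 6 := by
            apply pow_le_pow_left₀ hq.le; linarith
        _ = 64 := by norm_num
    rcases le_or_gt 0 X with hX0 | hX0
    · calc X * (1 + y / A) ^ 6 ≤ K₁ * 64 := mul_le_mul hX h64 hq6.le hK₁
        _ ≤ 64 * (K₁ + K₂) := by nlinarith
    · have : X * (1 + y / A) ^ 6 ≤ 0 := mul_nonpos_of_nonpos_of_nonneg hX0.le hq6.le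
      nlinarith
  · have hX := h2 hyA
    -- `1 + y/A ≤ 2y/A`, so `(1+y/A)^6 (A/y)^6 ≤ 64`
    have hr : 1 ≤ y / A := (one_le_div hA).2 hyA.le
    have hprod : (1 + y / A) * (A / y) ≤ 2 := by
      have e : (1 + y / A) * (A / y) = A / y + 1 := by field_simp
      rw [e]
      have : A / y ≤ 1 := (div_le_one hy).2 hyA.le
      linarith
    have hprod6 : (1 + y / A) ^ 6 * (A / y) ^ 6 ≤ 64 := by
      rw [← mul_pow]
      calc ((1 + y / A) * (A / y)) ^ 6 ≤ (2 : ℝ) ^ 6 :=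
            pow_le_pow_left₀ (by positivity) hprod 6
        _ = 64 := by norm_num
    rcases le_or_gt 0 X with hX0 | hX0
    · calc X * (1 + y / A) ^ 6 ≤ K₂ * (A / y) ^ 6 * (1 + y / A) ^ 6 :=
            mul_le_mul_of_nonneg_right hX hq6.le
        _ = K₂ * ((1 + y / A) ^ 6 * (A / y) ^ 6) := by ring
        _ ≤ K₂ * 64 := mul_le_mul_of_nonneg_left hprod6 hK₂
        _ ≤ 64 * (K₁ + K₂) := by nlinarith
    · have : X * (1 + y / A) ^ 6 ≤ 0 := mul_nonpos_of_nonpos_of_nonneg hX0.le hq6.le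
      nlinarith

/-! ## The two raw bounds for `V`: `‖V‖ ≪ (‖w‖/y)^6` and `‖V − 1‖ ≪ (y/‖w‖)^{1/4}` -/

/-- `‖1/(2π)‖ = 1/(2π)` in `ℂ`. [folklore] -/
private theorem norm_inv_two_pi : ‖(1 / (2 * Real.pi) : ℂ)‖ = 1 / (2 * Real.pi) := by
  have h : (0 : ℝ) < 2 * Real.pi := by positivity
  rw [show (1 / (2 * Real.pi) : ℂ) = ((1 / (2 * Real.pi) : ℝ) : ℂ) by push_cast; ring,
    Complex.norm_real, Real.norm_eq_abs, abs_of_pos (by positivity)]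

/-- **(7.16) with `A = 6`**: `‖V(w,y)‖ ≤ K (‖w‖/y)^6`.
[cite: ConreyIwaniec2002, Lemma 7.2 (7.16)] -/
theorem norm_afeV_le_large {C : ℝ} (hC : 0 ≤ C)
    (hb : ∀ (w u : ℂ), 3 / 8 ≤ w.re → w.re ≤ 5 / 8 → 1 / 2 ≤ |w.im| → -1 / 4 ≤ u.re → u.re ≤ 6 →
      ‖Complex.Gamma (w + u) / Complex.Gamma w‖ ≤
        C * ‖w‖ ^ u.re * (1 + |u.im|) ^ 7 * Real.exp (π * |u.im| / 2))
    {w : ℂ} (hw1 : 3 / 8 ≤ w.re) (hw2 : w.re ≤ 5 / 8) (hwi : 1 / 2 ≤ |w.im|) {y : ℝ} (hy : 0 < y) :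
    ‖afeV w y‖ ≤ (1 / (2 * Real.pi) * (C * Real.exp (6 ^ 2 + ((7 : ℝ) + 2) ^ 2 / 2) *
      Real.sqrt (2 * π) / 6)) * (‖w‖ / y) ^ 6 := by
  have hw0 : 0 < ‖w‖ := by
    have := Complex.abs_im_le_norm w; linarith
  rw [afeV_eq_line_six hC hb hw1 hw2 hwi hy, norm_mul, norm_inv_two_pi]
  have h := norm_integral_lineF_le (h := fun u : ℂ ↦ Complex.Gamma (w + u) / Complex.Gamma w)
    (k := 1) (n := 7) (c := 6) (M := C * ‖w‖ ^ (6 : ℝ)) hy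
    (Or.inr (by norm_num)) (gammaRatio_line_bound hb hw1 hw2 hwi (by norm_num) le_rfl)
  refine (mul_le_mul_of_nonneg_left h (by positivity)).trans (le_of_eq ?_)
  rw [← rpow_six_mul_rpow_neg_six (A := ‖w‖) hy, show |(6 : ℝ)| = 6 by norm_num]
  ring

/-- **(7.17)**: `‖V(w,y) − 1‖ ≤ K (y/‖w‖)^{1/4}`.
[cite: ConreyIwaniec2002, Lemma 7.2 (7.17)] -/
theorem norm_afeV_sub_one_le {C : ℝ} (hC : 0 ≤ C)
    (hb : ∀ (w u : ℂ), 3 / 8 ≤ w.re → w.re ≤ 5 / 8 → 1 / 2 ≤ |w.im| → -1 / 4 ≤ u.re → u.re ≤ 6 →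
      ‖Complex.Gamma (w + u) / Complex.Gamma w‖ ≤
        C * ‖w‖ ^ u.re * (1 + |u.im|) ^ 7 * Real.exp (π * |u.im| / 2))
    {w : ℂ} (hw1 : 3 / 8 ≤ w.re) (hw2 : w.re ≤ 5 / 8) (hwi : 1 / 2 ≤ |w.im|) {y : ℝ} (hy : 0 < y) :
    ‖afeV w y - 1‖ ≤ (1 / (2 * Real.pi) * (C * Real.exp ((-1 / 4) ^ 2 + ((7 : ℝ) + 2) ^ 2 / 2) *
      Real.sqrt (2 * π) / (1 / 4))) * (y / ‖w‖) ^ (1 / 4 : ℝ) := by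
  have hw0 : 0 < ‖w‖ := by
    have := Complex.abs_im_le_norm w; linarith
  rw [afeV_sub_one_eq_line hC hb hw1 hw2 hwi hy, norm_mul, norm_inv_two_pi]
  have h := norm_integral_lineF_le (h := fun u : ℂ ↦ Complex.Gamma (w + u) / Complex.Gamma w)
    (k := 1) (n := 7) (c := -1 / 4) (M := C * ‖w‖ ^ (-1 / 4 : ℝ))
    hy (Or.inr (by norm_num)) (gammaRatio_line_bound hb hw1 hw2 hwi le_rfl (by norm_num))
  simp only [pow_one] at h
  refine (mul_le_mul_of_nonneg_left h (by positivity)).trans (le_of_eq ?_)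
  rw [← rpow_neg_quarter_mul hw0 hy.le, show |(-1 / 4 : ℝ)| = 1 / 4 by norm_num,
    show (-(-1 / 4 : ℝ)) = 1 / 4 by norm_num, show (-1 / 4 : ℝ) = -(1 / 4) by norm_num]
  ring

/-! ## The `y`-derivative under the integral sign -/

/-- **`V(w,·)` is differentiable on `(0,∞)` and `y ∂_y V(w,y) = −(1/2π)∫ F₀(1+iv) dv`** with
`F₀(u) = h_w(u) e^{u²} y^{−u}` (the `y`-derivative of `y^{−u}/u` is `−y^{−u−1}`, killing the pole
at `u = 0`; differentiation under the integral sign against the Gaussian majorant).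
[cite: ConreyIwaniec2002, Lemma 7.2 (proof, derivatives in y)] -/
theorem hasDerivAt_afeV {w : ℂ} (hw1 : 3 / 8 ≤ w.re) (hw2 : w.re ≤ 5 / 8) (hwi : 1 / 2 ≤ |w.im|)
    {y : ℝ} (hy : 0 < y) :
    ∃ D : ℂ, HasDerivAt (afeV w) D y ∧
      (y : ℂ) * D = -(1 / (2 * Real.pi) : ℂ) * ∫ v : ℝ,
        (fun u : ℂ ↦ Complex.Gamma (w + u) / Complex.Gamma w) (((1 : ℝ) : ℂ) + v * I) *
          cexp ((((1 : ℝ) : ℂ) + v * I) ^ 2) * (y : ℂ) ^ (-(((1 : ℝ) : ℂ) + v * I)) /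
            (((1 : ℝ) : ℂ) + v * I) ^ 0 := by
  obtain ⟨C, hC, hb⟩ := exists_norm_Gamma_add_div_le
  set h : ℂ → ℂ := fun u : ℂ ↦ Complex.Gamma (w + u) / Complex.Gamma w with hh
  -- the integrand and its `y`-derivative
  set F : ℝ → ℝ → ℂ := fun y' v ↦ h (((1 : ℝ) : ℂ) + v * I) * cexp ((((1 : ℝ) : ℂ) + v * I) ^ 2) *
    (y' : ℂ) ^ (-(((1 : ℝ) : ℂ) + v * I)) / (((1 : ℝ) : ℂ) + v * I) ^ 1 with hF
  set F' : ℝ → ℝ → ℂ := fun y' v ↦ h (((1 : ℝ) : ℂ) + v * I) * cexp ((((1 : ℝ) : ℂ) + v * I) ^ 2) *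
    (-(((1 : ℝ) : ℂ) + v * I) * (y' : ℂ) ^ (-(((1 : ℝ) : ℂ) + v * I) - 1)) /
      (((1 : ℝ) : ℂ) + v * I) ^ 1 with hF'
  have hM : ∀ v : ℝ, ‖h (((1 : ℝ) : ℂ) + v * I)‖ ≤ C * ‖w‖ ^ (1 : ℝ) * (1 + |v|) ^ 7 *
      Real.exp (π * |v| / 2) := gammaRatio_line_bound hb hw1 hw2 hwi (by norm_num) (by norm_num)
  have hcont : Continuous fun v : ℝ ↦ h (((1 : ℝ) : ℂ) + v * I) :=
    continuous_gammaRatio_line hw1 (by norm_num)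
  have hu0 : ∀ v : ℝ, (((1 : ℝ) : ℂ) + v * I) ≠ 0 := by
    intro v h0; have := congrArg Complex.re h0; simp at this
  -- the dominated-convergence derivative lemma
  have hs : Ioo (y / 2) (2 * y) ∈ 𝓝 y := Ioo_mem_nhds (by linarith) (by linarith)
  have hF_meas : ∀ᶠ y' in 𝓝 y, AEStronglyMeasurable (F y') volume := by
    filter_upwards [eventually_gt_nhds hy] with y' hy'
    exact (continuous_lineF hy' (Or.inr one_ne_zero) hcont).aestronglyMeasurable
  have hF_int : Integrable (F y) := integrable_lineF hy (Or.inr one_ne_zero) hcont hM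
  have hF'_meas : AEStronglyMeasurable (F' y) volume := by
    have hl : Continuous fun v : ℝ ↦ ((1 : ℝ) : ℂ) + v * I := by fun_prop
    refine (Continuous.div ((hcont.mul (Complex.continuous_exp.comp (hl.pow 2))).mul
      (hl.neg.mul (Continuous.const_cpow (hl.neg.sub continuous_const)
        (Or.inl (by exact_mod_cast hy.ne'))))) (hl.pow 1) fun v ↦ ?_).aestronglyMeasurable
    rw [pow_one]; exact hu0 v
  -- the majorant of `F'` on `y' ∈ (y/2, 2y)`
  have h_bound : ∀ᵐ v ∂volume, ∀ y' ∈ Ioo (y / 2) (2 * y), ‖F' y' v‖ ≤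
      C * ‖w‖ ^ (1 : ℝ) * Real.exp (1 ^ 2 + ((7 : ℝ) + 2) ^ 2 / 2) * (2 / y) ^ 2 *
        Real.exp (-(v ^ 2 / 2)) := by
    refine Filter.Eventually.of_forall fun v y' hy' ↦ ?_
    have hy'0 : 0 < y' := by linarith [hy'.1]
    set u : ℂ := ((1 : ℝ) : ℂ) + v * I with hu
    -- `‖h(u) e^{u²}‖ ≤ M e^{1+81/2} e^{-v²/2}` (the line bound at base `1`, `k = 0`)
    have h1 := norm_lineF_le (h := h) (k := 0) (n := 7) (c := 1) (y := 1) one_pos (Or.inl rfl) hM v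
    simp only [pow_zero, div_one, Complex.ofReal_one, Complex.one_cpow, mul_one,
      Real.one_rpow, abs_one] at h1
    -- `‖y'^{-u-1}‖ = y'^{-2} ≤ (2/y)^2`
    have h2 : ‖(y' : ℂ) ^ (-u - 1)‖ ≤ (2 / y) ^ 2 := by
      rw [Complex.norm_cpow_eq_rpow_re_of_pos hy'0]
      have hre : (-u - 1).re = -2 := by simp [hu]; norm_num
      rw [hre, show (-2 : ℝ) = -((2 : ℕ) : ℝ) by norm_num, Real.rpow_neg hy'0.le,
        Real.rpow_natCast, ← inv_pow, show (2 / y) = (y / 2)⁻¹ by rw [inv_div]]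
      rw [inv_pow, inv_pow]
      apply inv_anti₀ (by positivity)
      apply pow_le_pow_left₀ (by positivity) hy'.1.le
    have hnorm : ‖F' y' v‖ = ‖h u * cexp (u ^ 2)‖ * ‖(y' : ℂ) ^ (-u - 1)‖ := by
      simp only [hF', ← hu]
      rw [pow_one, norm_div, norm_mul (h u * cexp (u ^ 2)), norm_mul (-u), norm_neg]
      have hu' : ‖u‖ ≠ 0 := norm_ne_zero_iff.2 (hu0 v)
      field_simp
    rw [hnorm]
    have e1 : ‖h u * cexp (u ^ 2)‖ ≤ C * ‖w‖ ^ (1 : ℝ) * Real.exp (1 ^ 2 + ((7 : ℝ) + 2) ^ 2 / 2) *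
        Real.exp (-(v ^ 2 / 2)) := by simpa [hu] using h1
    calc ‖h u * cexp (u ^ 2)‖ * ‖(y' : ℂ) ^ (-u - 1)‖
        ≤ (C * ‖w‖ ^ (1 : ℝ) * Real.exp (1 ^ 2 + ((7 : ℝ) + 2) ^ 2 / 2) *
            Real.exp (-(v ^ 2 / 2))) * (2 / y) ^ 2 :=
          mul_le_mul e1 h2 (norm_nonneg _) (by positivity)
      _ = _ := by ring
  have h_bound_int : Integrable (fun v : ℝ ↦ C * ‖w‖ ^ (1 : ℝ) *
      Real.exp (1 ^ 2 + ((7 : ℝ) + 2) ^ 2 / 2) * (2 / y) ^ 2 * Real.exp (-(v ^ 2 / 2))) :=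
    (integrable_exp_neg_sq_half').const_mul _
  have h_diff : ∀ᵐ v ∂volume, ∀ y' ∈ Ioo (y / 2) (2 * y), HasDerivAt (fun x ↦ F x v) (F' y' v) y' := by
    refine Filter.Eventually.of_forall fun v y' hy' ↦ ?_
    have hy'0 : y' ≠ 0 := by linarith [hy'.1]
    have hd := hasDerivAt_ofReal_cpow_const hy'0 (r := -(((1 : ℝ) : ℂ) + v * I))
      (neg_ne_zero.2 (hu0 v))
    have := (hd.const_mul (h (((1 : ℝ) : ℂ) + v * I) * cexp ((((1 : ℝ) : ℂ) + v * I) ^ 2))).div_const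
      ((((1 : ℝ) : ℂ) + v * I) ^ 1)
    simpa only [hF, hF'] using this
  have key := (hasDerivAt_integral_of_dominated_loc_of_deriv_le hs hF_meas hF_int hF'_meas h_bound
    h_bound_int h_diff).2
  -- assemble
  refine ⟨(1 / (2 * Real.pi) : ℂ) * ∫ v : ℝ, F' y v, ?_, ?_⟩
  · have hfun : afeV w = fun y' : ℝ ↦ (1 / (2 * Real.pi) : ℂ) * ∫ v : ℝ, F y' v := by
      funext y'; rw [afeV_eq_lineF]
    rw [hfun]
    exact key.const_mul _
  · -- `y · F'(y,v) = - F₀(1+iv)`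
    have hpt : ∀ v : ℝ, (y : ℂ) * F' y v =
        -(h (((1 : ℝ) : ℂ) + v * I) * cexp ((((1 : ℝ) : ℂ) + v * I) ^ 2) *
          (y : ℂ) ^ (-(((1 : ℝ) : ℂ) + v * I)) / (((1 : ℝ) : ℂ) + v * I) ^ 0) := by
      intro v
      have hy0 : (y : ℂ) ≠ 0 := by exact_mod_cast hy.ne'
      have hpow : (y : ℂ) * (y : ℂ) ^ (-(((1 : ℝ) : ℂ) + v * I) - 1) =
          (y : ℂ) ^ (-(((1 : ℝ) : ℂ) + v * I)) := by
        rw [Complex.cpow_sub _ _ hy0, Complex.cpow_one]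
        field_simp
      simp only [hF', pow_one, pow_zero, div_one]
      have hu' := hu0 v
      field_simp
      rw [← hpow]
      ring
    calc (y : ℂ) * ((1 / (2 * Real.pi) : ℂ) * ∫ v : ℝ, F' y v)
        = (1 / (2 * Real.pi) : ℂ) * ∫ v : ℝ, (y : ℂ) * F' y v := by
          rw [integral_const_mul]; ring
      _ = (1 / (2 * Real.pi) : ℂ) * ∫ v : ℝ,
          -(h (((1 : ℝ) : ℂ) + v * I) * cexp ((((1 : ℝ) : ℂ) + v * I) ^ 2) *
            (y : ℂ) ^ (-(((1 : ℝ) : ℂ) + v * I)) / (((1 : ℝ) : ℂ) + v * I) ^ 0) := by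
          congr 1
          exact integral_congr_ae (Filter.Eventually.of_forall hpt)
      _ = _ := by rw [integral_neg]; ring

/-! ## Bounds for `y ∂_y V` -/

/-- **`‖y ∂_y V(w,y)‖ ≤ K (‖w‖/y)^6`** (shift of the pole-free integrand `F₀` to `Re u = 6`).
[cite: ConreyIwaniec2002, Lemma 7.2 (7.16) (derivative form)] -/
theorem norm_mul_deriv_afeV_le_large {C : ℝ} (hC : 0 ≤ C)
    (hb : ∀ (w u : ℂ), 3 / 8 ≤ w.re → w.re ≤ 5 / 8 → 1 / 2 ≤ |w.im| → -1 / 4 ≤ u.re → u.re ≤ 6 →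
      ‖Complex.Gamma (w + u) / Complex.Gamma w‖ ≤
        C * ‖w‖ ^ u.re * (1 + |u.im|) ^ 7 * Real.exp (π * |u.im| / 2))
    {w : ℂ} (hw1 : 3 / 8 ≤ w.re) (hw2 : w.re ≤ 5 / 8) (hwi : 1 / 2 ≤ |w.im|) {y : ℝ} (hy : 0 < y) :
    DifferentiableAt ℝ (afeV w) y ∧
    ‖(y : ℂ) * deriv (afeV w) y‖ ≤ (1 / (2 * Real.pi) * (C * Real.exp (6 ^ 2 + ((7 : ℝ) + 2) ^ 2 / 2) *
      Real.sqrt (2 * π))) * (‖w‖ / y) ^ 6 := by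
  have hw0 : 0 < ‖w‖ := by
    have := Complex.abs_im_le_norm w; linarith
  obtain ⟨D, hD, hyD⟩ := hasDerivAt_afeV hw1 hw2 hwi hy
  refine ⟨hD.differentiableAt, ?_⟩
  rw [hD.deriv, hyD, norm_mul, norm_neg, norm_inv_two_pi]
  -- shift `F₀` from `Re u = 1` to `Re u = 6`
  rw [integral_lineF_eq_of_noPole (h := fun u : ℂ ↦ Complex.Gamma (w + u) / Complex.Gamma w)
    (a := 1) (b := 6) (k := 0) (n := 7) (by norm_num) hy (Or.inl rfl)
    (differentiableOn_gammaRatio hw1 (by norm_num))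
    (gammaRatio_strip_bound hC hb hw1 hw2 hwi (by norm_num) le_rfl)]
  have h := norm_integral_lineF_le (h := fun u : ℂ ↦ Complex.Gamma (w + u) / Complex.Gamma w)
    (k := 0) (n := 7) (c := 6) (M := C * ‖w‖ ^ (6 : ℝ)) hy
    (Or.inl rfl) (gammaRatio_line_bound hb hw1 hw2 hwi (by norm_num) le_rfl)
  refine (mul_le_mul_of_nonneg_left h (by positivity)).trans (le_of_eq ?_)
  rw [← rpow_six_mul_rpow_neg_six (A := ‖w‖) hy, pow_zero, div_one]
  ring

/-- **`‖y ∂_y V(w,y)‖ ≤ K (y/‖w‖)^{1/4}`** (shift of `F₀` to `Re u = −1/4`; no residue since the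
`y`-derivative removed the pole at `u = 0`). [cite: ConreyIwaniec2002, Lemma 7.2 (7.17) (derivative form)] -/
theorem norm_mul_deriv_afeV_le_small {C : ℝ} (hC : 0 ≤ C)
    (hb : ∀ (w u : ℂ), 3 / 8 ≤ w.re → w.re ≤ 5 / 8 → 1 / 2 ≤ |w.im| → -1 / 4 ≤ u.re → u.re ≤ 6 →
      ‖Complex.Gamma (w + u) / Complex.Gamma w‖ ≤
        C * ‖w‖ ^ u.re * (1 + |u.im|) ^ 7 * Real.exp (π * |u.im| / 2))
    {w : ℂ} (hw1 : 3 / 8 ≤ w.re) (hw2 : w.re ≤ 5 / 8) (hwi : 1 / 2 ≤ |w.im|) {y : ℝ} (hy : 0 < y) :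
    ‖(y : ℂ) * deriv (afeV w) y‖ ≤ (1 / (2 * Real.pi) * (C * Real.exp ((-1 / 4) ^ 2 +
      ((7 : ℝ) + 2) ^ 2 / 2) * Real.sqrt (2 * π))) * (y / ‖w‖) ^ (1 / 4 : ℝ) := by
  have hw0 : 0 < ‖w‖ := by
    have := Complex.abs_im_le_norm w; linarith
  obtain ⟨D, hD, hyD⟩ := hasDerivAt_afeV hw1 hw2 hwi hy
  rw [hD.deriv, hyD, norm_mul, norm_neg, norm_inv_two_pi]
  -- shift `F₀` from `Re u = 1` back to `Re u = -1/4`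
  rw [← integral_lineF_eq_of_noPole (h := fun u : ℂ ↦ Complex.Gamma (w + u) / Complex.Gamma w)
    (a := -1 / 4) (b := 1) (k := 0) (n := 7) (by norm_num) hy (Or.inl rfl)
    (differentiableOn_gammaRatio hw1 le_rfl)
    (gammaRatio_strip_bound hC hb hw1 hw2 hwi le_rfl (by norm_num))]
  have h := norm_integral_lineF_le (h := fun u : ℂ ↦ Complex.Gamma (w + u) / Complex.Gamma w)
    (k := 0) (n := 7) (c := -1 / 4) (M := C * ‖w‖ ^ (-1 / 4 : ℝ)) hy
    (Or.inl rfl) (gammaRatio_line_bound hb hw1 hw2 hwi le_rfl (by norm_num))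
  refine (mul_le_mul_of_nonneg_left h (by positivity)).trans (le_of_eq ?_)
  rw [← rpow_neg_quarter_mul hw0 hy.le, pow_zero, div_one,
    show (-(-1 / 4 : ℝ)) = 1 / 4 by norm_num, show (-1 / 4 : ℝ) = -(1 / 4) by norm_num]
  ring

/-! ## Packaging: the `(1 + y/‖w‖)^{-6}` forms of Lemma 7.2 -/

/-- **Lemma 7.2 for `V` and `y∂_yV` in packaged form**: with one constant `K`,
`‖V‖ ≤ K(1+y/‖w‖)^{-6}`, `‖V − 1‖ ≤ K(y/‖w‖)^{1/4}`, `V(w,·)` differentiable at `y`,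
`‖y∂_yV‖ ≤ K(1+y/‖w‖)^{-6}` and `‖y∂_yV‖ ≤ K(y/‖w‖)^{1/4}`, for `3/8 ≤ Re w ≤ 5/8`, `|Im w| ≥ 1/2`,
`y > 0`. [cite: ConreyIwaniec2002, Lemma 7.2 (7.16)–(7.17)] -/
theorem afeV_strip_bounds :
    ∃ K : ℝ, 0 < K ∧ ∀ (w : ℂ) (y : ℝ), 3 / 8 ≤ w.re → w.re ≤ 5 / 8 → 1 / 2 ≤ |w.im| → 0 < y →
      ‖afeV w y‖ ≤ K * ((1 + y / ‖w‖) ^ 6)⁻¹ ∧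
      ‖afeV w y - 1‖ ≤ K * (y / ‖w‖) ^ ((1 : ℝ) / 4) ∧
      DifferentiableAt ℝ (afeV w) y ∧
      ‖(y : ℂ) * deriv (afeV w) y‖ ≤ K * ((1 + y / ‖w‖) ^ 6)⁻¹ ∧
      ‖(y : ℂ) * deriv (afeV w) y‖ ≤ K * (y / ‖w‖) ^ ((1 : ℝ) / 4) := by
  obtain ⟨C, hC, hb⟩ := exists_norm_Gamma_add_div_le
  -- the four raw constants
  set K₆ : ℝ := 1 / (2 * Real.pi) * (C * Real.exp (6 ^ 2 + ((7 : ℝ) + 2) ^ 2 / 2) *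
    Real.sqrt (2 * π) / 6) with hK₆
  set K₁ : ℝ := 1 / (2 * Real.pi) * (C * Real.exp ((-1 / 4) ^ 2 + ((7 : ℝ) + 2) ^ 2 / 2) *
    Real.sqrt (2 * π) / (1 / 4)) with hK₁
  set L₆ : ℝ := 1 / (2 * Real.pi) * (C * Real.exp (6 ^ 2 + ((7 : ℝ) + 2) ^ 2 / 2) *
    Real.sqrt (2 * π)) with hL₆
  set L₁ : ℝ := 1 / (2 * Real.pi) * (C * Real.exp ((-1 / 4) ^ 2 + ((7 : ℝ) + 2) ^ 2 / 2) *
    Real.sqrt (2 * π)) with hL₁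
  have hK₆0 : 0 < K₆ := by positivity
  have hK₁0 : 0 < K₁ := by positivity
  have hL₆0 : 0 < L₆ := by positivity
  have hL₁0 : 0 < L₁ := by positivity
  refine ⟨64 * (1 + K₁ + K₆) + K₁ + 64 * (L₁ + L₆) + L₁, by positivity,
    fun w y hw1 hw2 hwi hy ↦ ?_⟩
  have hw0 : 0 < ‖w‖ := by
    have := Complex.abs_im_le_norm w; linarith
  have hV1 : ‖afeV w y - 1‖ ≤ K₁ * (y / ‖w‖) ^ (1 / 4 : ℝ) :=
    norm_afeV_sub_one_le hC.le hb hw1 hw2 hwi hy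
  have hV6 : ‖afeV w y‖ ≤ K₆ * (‖w‖ / y) ^ 6 := norm_afeV_le_large hC.le hb hw1 hw2 hwi hy
  obtain ⟨hdiff, hD6⟩ := norm_mul_deriv_afeV_le_large hC.le hb hw1 hw2 hwi hy
  have hD1 : ‖(y : ℂ) * deriv (afeV w) y‖ ≤ L₁ * (y / ‖w‖) ^ (1 / 4 : ℝ) :=
    norm_mul_deriv_afeV_le_small hC.le hb hw1 hw2 hwi hy
  have hr0 : 0 ≤ y / ‖w‖ := by positivity
  -- `(y/‖w‖)^{1/4} ≤ 1` when `y ≤ ‖w‖`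
  have hsmall : y ≤ ‖w‖ → (y / ‖w‖) ^ (1 / 4 : ℝ) ≤ 1 := fun hyw ↦
    Real.rpow_le_one hr0 ((div_le_one hw0).2 hyw) (by norm_num)
  have hinv0 : 0 ≤ ((1 + y / ‖w‖) ^ 6)⁻¹ := by positivity
  -- (a)
  have ha : ‖afeV w y‖ ≤ 64 * ((1 + K₁) + K₆) * ((1 + y / ‖w‖) ^ 6)⁻¹ := by
    refine le_inv_one_add_pow_six hw0 hy (by positivity) hK₆0.le (fun hyw ↦ ?_) (fun _ ↦ hV6)
    calc ‖afeV w y‖ = ‖(afeV w y - 1) + 1‖ := by rw [sub_add_cancel]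
      _ ≤ ‖afeV w y - 1‖ + ‖(1 : ℂ)‖ := norm_add_le _ _
      _ ≤ K₁ * (y / ‖w‖) ^ (1 / 4 : ℝ) + 1 := by rw [norm_one]; gcongr
      _ ≤ K₁ * 1 + 1 := by gcongr; exact hsmall hyw
      _ = 1 + K₁ := by ring
  -- (c) first form
  have hc : ‖(y : ℂ) * deriv (afeV w) y‖ ≤ 64 * (L₁ + L₆) * ((1 + y / ‖w‖) ^ 6)⁻¹ := by
    refine le_inv_one_add_pow_six hw0 hy hL₁0.le hL₆0.le (fun hyw ↦ ?_) (fun _ ↦ hD6)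
    calc ‖(y : ℂ) * deriv (afeV w) y‖ ≤ L₁ * (y / ‖w‖) ^ (1 / 4 : ℝ) := hD1
      _ ≤ L₁ * 1 := by gcongr; exact hsmall hyw
      _ = L₁ := mul_one _
  have hrq0 : 0 ≤ (y / ‖w‖) ^ (1 / 4 : ℝ) := Real.rpow_nonneg hr0 _
  refine ⟨?_, ?_, hdiff, ?_, ?_⟩
  · refine ha.trans ?_
    rw [show 64 * ((1 + K₁) + K₆) = 64 * (1 + K₁ + K₆) by ring]
    gcongr
    linarith
  · refine hV1.trans ?_
    gcongr
    linarith
  · refine hc.trans ?_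
    gcongr
    linarith
  · refine hD1.trans ?_
    gcongr
    linarith

/-! ## Divided differences in `s` on the critical line (Lemma 7.4, the part used in §8)

For `s = ½ + it`, `s′ = ½ + it′` with `|t| ≥ 2`, `0 < |t − t′| ≤ 1`, the divided difference of
`w ↦ Γ(w+u)/Γ(w)` between `s′` and `s` is again of Stirling class on the lines `−1/4 ≤ Re u ≤ 6`
(Cauchy's estimate on circles of radius `1/8` around the segment `[s′, s]`, where `3/8 ≤ Re ≤ 5/8`
and `|Im| ≥ 7/8`), with the scale `‖s‖`; and it VANISHES at `u = 0`, so the shift to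
`Re u = −1/4` produces no residue. -/

/-- `w ↦ Γ(w+u)/Γ(w)` is holomorphic at every `z` with `Re z > 1/4` when `Re u ≥ −1/4`. [folklore] -/
private theorem differentiableAt_gammaRatio_base {z u : ℂ} (hz : 1 / 4 < z.re) (hu : -1 / 4 ≤ u.re) :
    DifferentiableAt ℂ (fun z : ℂ ↦ Complex.Gamma (z + u) / Complex.Gamma z) z := by
  have hne : ∀ m : ℕ, z + u ≠ -(m : ℂ) := by
    intro m h
    have := congrArg Complex.re h
    simp at this
    linarith
  have h1 : DifferentiableAt ℂ (fun z : ℂ ↦ Complex.Gamma (z + u)) z :=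
    (Complex.differentiableAt_Gamma _ hne).comp z ((differentiableAt_id).add_const u)
  have hne' : ∀ m : ℕ, z ≠ -(m : ℂ) := by
    intro m h
    have := congrArg Complex.re h
    simp at this
    linarith
  exact h1.div (Complex.differentiableAt_Gamma _ hne') (Complex.Gamma_ne_zero_of_re_pos (by linarith))

/-- Geometry of the Cauchy circles: for `Re x = 1/2`, `|Im x − t| ≤ 1`, `|t| ≥ 2` and
`‖ζ − x‖ = 1/8`: `3/8 ≤ Re ζ ≤ 5/8`, `|Im ζ| ≥ 1/2` and `(7/16)‖s‖ ≤ ‖ζ‖ ≤ (25/16)‖s‖`,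
`s = 1/2 + it`. [folklore] -/
private theorem sphere_geometry {x ζ : ℂ} {t : ℝ} (hx : x.re = 1 / 2) (hxt : |x.im - t| ≤ 1)
    (ht : 2 ≤ |t|) (hζ : ‖ζ - x‖ = 1 / 8) :
    3 / 8 ≤ ζ.re ∧ ζ.re ≤ 5 / 8 ∧ 1 / 2 ≤ |ζ.im| ∧
      7 / 16 * ‖(1 / 2 : ℂ) + t * I‖ ≤ ‖ζ‖ ∧ ‖ζ‖ ≤ 25 / 16 * ‖(1 / 2 : ℂ) + t * I‖ := by
  have hre : |ζ.re - x.re| ≤ 1 / 8 := by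
    have := Complex.abs_re_le_norm (ζ - x); simpa [hζ] using this
  have him : |ζ.im - x.im| ≤ 1 / 8 := by
    have := Complex.abs_im_le_norm (ζ - x); simpa [hζ] using this
  rw [hx] at hre
  have hre' := abs_le.1 hre
  have him' := abs_le.1 him
  have hxt' := abs_le.1 hxt
  -- `‖s‖ ≥ |t| ≥ 2`
  have hs2 : 2 ≤ ‖(1 / 2 : ℂ) + t * I‖ := by
    have h := Complex.abs_im_le_norm ((1 / 2 : ℂ) + t * I)
    have e : ((1 / 2 : ℂ) + t * I).im = t := by simp
    rw [e] at h
    exact ht.trans h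
  -- `‖x - s‖ ≤ 1`
  have hxs : ‖x - ((1 / 2 : ℂ) + t * I)‖ ≤ 1 := by
    refine (Complex.norm_le_abs_re_add_abs_im _).trans ?_
    have e1 : (x - ((1 / 2 : ℂ) + t * I)).re = 0 := by simp [hx]
    have e2 : (x - ((1 / 2 : ℂ) + t * I)).im = x.im - t := by simp
    rw [e1, e2, abs_zero, zero_add]
    exact hxt
  have hζs : ‖ζ - ((1 / 2 : ℂ) + t * I)‖ ≤ 9 / 8 := by
    calc ‖ζ - ((1 / 2 : ℂ) + t * I)‖ = ‖(ζ - x) + (x - ((1 / 2 : ℂ) + t * I))‖ := by ring_nf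
      _ ≤ ‖ζ - x‖ + ‖x - ((1 / 2 : ℂ) + t * I)‖ := norm_add_le _ _
      _ ≤ 1 / 8 + 1 := by rw [hζ]; gcongr
      _ = 9 / 8 := by norm_num
  have hup : ‖ζ‖ ≤ ‖(1 / 2 : ℂ) + t * I‖ + 9 / 8 := by
    have := norm_add_le (ζ - ((1 / 2 : ℂ) + t * I)) ((1 / 2 : ℂ) + t * I)
    rw [sub_add_cancel] at this
    linarith
  have hlo : ‖(1 / 2 : ℂ) + t * I‖ - 9 / 8 ≤ ‖ζ‖ := by
    have := norm_sub_norm_le ((1 / 2 : ℂ) + t * I) ζ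
    rw [norm_sub_rev] at this
    linarith
  -- `|ζ.im| ≥ |x.im| - 1/8 ≥ |t| - 1 - 1/8`
  have hζim : 1 / 2 ≤ |ζ.im| := by
    have h1 : |t| - 1 ≤ |x.im| := by
      have := abs_sub_abs_le_abs_sub t x.im
      rw [abs_sub_comm] at this
      linarith
    have h2 : |x.im| - 1 / 8 ≤ |ζ.im| := by
      have := abs_sub_abs_le_abs_sub x.im ζ.im
      rw [abs_sub_comm] at this
      linarith
    linarith
  refine ⟨by linarith, by linarith, hζim, by linarith, by linarith⟩

/-- `b^c ≤ 15 a^c` for `(7/16)a ≤ b ≤ (25/16)a`, `a > 0`, `−1/4 ≤ c ≤ 6`. [folklore] -/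
private theorem rpow_le_fifteen_mul {a b c : ℝ} (ha : 0 < a) (h1 : 7 / 16 * a ≤ b) (h2 : b ≤ 25 / 16 * a)
    (hc1 : -1 / 4 ≤ c) (hc2 : c ≤ 6) : b ^ c ≤ 15 * a ^ c := by
  have hb : 0 < b := by linarith
  have hac : 0 ≤ a ^ c := Real.rpow_nonneg ha.le c
  rcases le_or_gt 0 c with hc | hc
  · calc b ^ c ≤ (25 / 16 * a) ^ c := Real.rpow_le_rpow hb.le h2 hc
      _ = (25 / 16 : ℝ) ^ c * a ^ c := Real.mul_rpow (by norm_num) ha.le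
      _ ≤ (25 / 16 : ℝ) ^ (6 : ℝ) * a ^ c :=
          mul_le_mul_of_nonneg_right (Real.rpow_le_rpow_of_exponent_le (by norm_num) hc2) hac
      _ ≤ 15 * a ^ c := by
          refine mul_le_mul_of_nonneg_right ?_ hac
          rw [show (6 : ℝ) = ((6 : ℕ) : ℝ) by norm_num, Real.rpow_natCast]
          norm_num
  · calc b ^ c ≤ (7 / 16 * a) ^ c := Real.rpow_le_rpow_of_nonpos (by positivity) h1 hc.le
      _ = (7 / 16 : ℝ) ^ c * a ^ c := Real.mul_rpow (by norm_num) ha.le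
      _ ≤ (7 / 16 : ℝ) ^ (-1 : ℝ) * a ^ c :=
          mul_le_mul_of_nonneg_right
            (Real.rpow_le_rpow_of_exponent_ge (by norm_num) (by norm_num) (by linarith)) hac
      _ ≤ 15 * a ^ c := by
          refine mul_le_mul_of_nonneg_right ?_ hac
          rw [Real.rpow_neg_one]; norm_num

/-- **Cauchy's estimate for `w ↦ Γ(w+u)/Γ(w)` along the segment**: for `Re x = 1/2`,
`|Im x − t| ≤ 1`, `|t| ≥ 2`, `−1/4 ≤ Re u ≤ 6`:
`‖∂_w (Γ(w+u)/Γ(w))|_{w=x}‖ ≤ 120 C ‖s‖^{Re u} (1+|Im u|)^7 e^{π|Im u|/2}`, `s = ½ + it`.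
[cite: ConreyIwaniec2002, Lemma 7.4 (proof, derivatives in s)] -/
theorem norm_deriv_gammaRatio_le {C : ℝ} (hC : 0 ≤ C)
    (hb : ∀ (w u : ℂ), 3 / 8 ≤ w.re → w.re ≤ 5 / 8 → 1 / 2 ≤ |w.im| → -1 / 4 ≤ u.re → u.re ≤ 6 →
      ‖Complex.Gamma (w + u) / Complex.Gamma w‖ ≤
        C * ‖w‖ ^ u.re * (1 + |u.im|) ^ 7 * Real.exp (π * |u.im| / 2))
    {x : ℂ} {t : ℝ} (hx : x.re = 1 / 2) (hxt : |x.im - t| ≤ 1) (ht : 2 ≤ |t|) {u : ℂ}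
    (hu1 : -1 / 4 ≤ u.re) (hu2 : u.re ≤ 6) :
    ‖deriv (fun z : ℂ ↦ Complex.Gamma (z + u) / Complex.Gamma z) x‖ ≤
      120 * C * ‖(1 / 2 : ℂ) + t * I‖ ^ u.re * (1 + |u.im|) ^ 7 * Real.exp (π * |u.im| / 2) := by
  have hs0 : 0 < ‖(1 / 2 : ℂ) + t * I‖ := by
    have := Complex.abs_im_le_norm ((1 / 2 : ℂ) + t * I)
    simp at this
    linarith
  have hR : (0 : ℝ) < 1 / 8 := by norm_num
  -- holomorphy on the closed disc
  have hdiff : DiffContOnCl ℂ (fun z : ℂ ↦ Complex.Gamma (z + u) / Complex.Gamma z)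
      (Metric.ball x (1 / 8)) := by
    apply DifferentiableOn.diffContOnCl
    rw [closure_ball x hR.ne']
    intro z hz
    have hz' : ‖z - x‖ ≤ 1 / 8 := by simpa [dist_eq_norm] using hz
    have : |z.re - x.re| ≤ 1 / 8 := (Complex.abs_re_le_norm (z - x)).trans (by simpa using hz')
    rw [hx] at this
    have := (abs_le.1 this).1
    exact (differentiableAt_gammaRatio_base (by linarith) hu1).differentiableWithinAt
  -- the bound on the circle
  have hsph : ∀ ζ ∈ Metric.sphere x (1 / 8),
      ‖(fun z : ℂ ↦ Complex.Gamma (z + u) / Complex.Gamma z) ζ‖ ≤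
        15 * C * ‖(1 / 2 : ℂ) + t * I‖ ^ u.re * (1 + |u.im|) ^ 7 * Real.exp (π * |u.im| / 2) := by
    intro ζ hζ
    have hζ' : ‖ζ - x‖ = 1 / 8 := by simpa [dist_eq_norm] using hζ
    obtain ⟨h1, h2, h3, h4, h5⟩ := sphere_geometry hx hxt ht hζ'
    have hmain := hb ζ u h1 h2 h3 hu1 hu2
    have hpow := rpow_le_fifteen_mul hs0 h4 h5 hu1 hu2
    refine hmain.trans ?_
    have : 0 ≤ (1 + |u.im|) ^ 7 * Real.exp (π * |u.im| / 2) := by positivity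
    calc C * ‖ζ‖ ^ u.re * (1 + |u.im|) ^ 7 * Real.exp (π * |u.im| / 2)
        = C * ‖ζ‖ ^ u.re * ((1 + |u.im|) ^ 7 * Real.exp (π * |u.im| / 2)) := by ring
      _ ≤ C * (15 * ‖(1 / 2 : ℂ) + t * I‖ ^ u.re) *
          ((1 + |u.im|) ^ 7 * Real.exp (π * |u.im| / 2)) := by gcongr
      _ = _ := by ring
  have key := Complex.norm_deriv_le_of_forall_mem_sphere_norm_le hR hdiff hsph
  refine key.trans (le_of_eq ?_)
  ring

/-- A point of the segment `[s′, s]`: `Re = 1/2` and distance `≤ 1` from `t` in the imaginary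
part. [folklore] -/
private theorem segment_point {t t' : ℝ} (hclose : |t' - t| ≤ 1) {x : ℂ}
    (hx : x ∈ segment ℝ ((1 / 2 : ℂ) + t' * I) ((1 / 2 : ℂ) + t * I)) :
    x.re = 1 / 2 ∧ |x.im - t| ≤ 1 := by
  rw [segment_eq_image'] at hx
  obtain ⟨θ, hθ, rfl⟩ := hx
  refine ⟨by simp, ?_⟩
  have e : ((1 / 2 : ℂ) + t' * I + θ • ((1 / 2 : ℂ) + t * I - ((1 / 2 : ℂ) + t' * I))).im - t =
      (1 - θ) * (t' - t) := by
    simp; ring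
  rw [e, abs_mul, abs_of_nonneg (by linarith [hθ.2])]
  calc (1 - θ) * |t' - t| ≤ 1 * 1 := by
        apply mul_le_mul (by linarith [hθ.1]) hclose (abs_nonneg _) (by norm_num)
    _ = 1 := by norm_num

/-- **Stirling class of the divided difference** `u ↦ (Γ(s+u)/Γ(s) − Γ(s′+u)/Γ(s′))/(s − s′)` on
the lines `−1/4 ≤ Re u ≤ 6` (`s = ½+it`, `s′ = ½+it′`, `|t| ≥ 2`, `0 < |t−t′| ≤ 1`), with the scale
`‖s‖`: the mean value inequality along `[s′, s]` and `norm_deriv_gammaRatio_le`.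
[cite: ConreyIwaniec2002, Lemma 7.4 (7.25) (proof, by the arguments of Lemma 7.2)] -/
theorem dd_gammaRatio_line_bound {C : ℝ} (hC : 0 ≤ C)
    (hb : ∀ (w u : ℂ), 3 / 8 ≤ w.re → w.re ≤ 5 / 8 → 1 / 2 ≤ |w.im| → -1 / 4 ≤ u.re → u.re ≤ 6 →
      ‖Complex.Gamma (w + u) / Complex.Gamma w‖ ≤
        C * ‖w‖ ^ u.re * (1 + |u.im|) ^ 7 * Real.exp (π * |u.im| / 2))
    {t t' : ℝ} (ht : 2 ≤ |t|) (htt' : t' ≠ t) (hclose : |t' - t| ≤ 1) {c : ℝ}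
    (hc1 : -1 / 4 ≤ c) (hc2 : c ≤ 6) (v : ℝ) :
    ‖(fun u : ℂ ↦ (Complex.Gamma ((1 / 2 : ℂ) + t * I + u) / Complex.Gamma ((1 / 2 : ℂ) + t * I) -
        Complex.Gamma ((1 / 2 : ℂ) + t' * I + u) / Complex.Gamma ((1 / 2 : ℂ) + t' * I)) /
        ((t : ℂ) * I - t' * I)) ((c : ℂ) + v * I)‖ ≤
      120 * C * ‖(1 / 2 : ℂ) + t * I‖ ^ c * (1 + |v|) ^ 7 * Real.exp (π * |v| / 2) := by
  set u : ℂ := (c : ℂ) + v * I with hu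
  have hure : u.re = c := by simp [hu]
  have huim : u.im = v := by simp [hu]
  set g : ℂ → ℂ := fun z : ℂ ↦ Complex.Gamma (z + u) / Complex.Gamma z with hg
  set L : ℝ := 120 * C * ‖(1 / 2 : ℂ) + t * I‖ ^ c * (1 + |v|) ^ 7 * Real.exp (π * |v| / 2) with hL
  -- mean value inequality on the segment
  have hd : (1 / 2 + t * I : ℂ) - (1 / 2 + t' * I) = (t : ℂ) * I - t' * I := by ring
  have hd0 : ((t : ℂ) * I - t' * I) ≠ 0 := by
    rw [← sub_mul]
    refine mul_ne_zero ?_ I_ne_zero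
    intro h
    apply htt'
    have := congrArg Complex.re h
    simp at this
    linarith
  have hMVT : ‖g ((1 / 2 : ℂ) + t * I) - g ((1 / 2 : ℂ) + t' * I)‖ ≤
      L * ‖((1 / 2 : ℂ) + t * I) - ((1 / 2 : ℂ) + t' * I)‖ := by
    apply Convex.norm_image_sub_le_of_norm_deriv_le (s := segment ℝ ((1 / 2 : ℂ) + t' * I)
      ((1 / 2 : ℂ) + t * I)) (f := g)
    · intro x hx
      obtain ⟨hxre, hxt⟩ := segment_point hclose hx
      exact differentiableAt_gammaRatio_base (by rw [hxre]; norm_num) (by rw [hure]; exact hc1)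
    · intro x hx
      obtain ⟨hxre, hxt⟩ := segment_point hclose hx
      have := norm_deriv_gammaRatio_le hC hb hxre hxt ht (u := u) (by rw [hure]; exact hc1)
        (by rw [hure]; exact hc2)
      rw [hure, huim] at this
      exact this
    · exact convex_segment _ _
    · exact left_mem_segment _ _ _
    · exact right_mem_segment _ _ _
  rw [hd] at hMVT
  have hL0 : 0 ≤ L := by positivity
  show ‖(g ((1 / 2 : ℂ) + t * I) - g ((1 / 2 : ℂ) + t' * I)) / ((t : ℂ) * I - t' * I)‖ ≤ L
  rw [norm_div, div_le_iff₀ (norm_pos_iff.2 hd0)]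
  exact hMVT

/-- Differentiability of the divided-difference numerator in `u` on the strips `Re u ≥ −1/4`.
[cite: ConreyIwaniec2002, Lemma 7.4 (proof)] -/
theorem differentiableOn_dd_gammaRatio (t t' : ℝ) {a b : ℝ} (ha : -1 / 4 ≤ a) :
    DifferentiableOn ℂ (fun u : ℂ ↦ (Complex.Gamma ((1 / 2 : ℂ) + t * I + u) /
        Complex.Gamma ((1 / 2 : ℂ) + t * I) -
        Complex.Gamma ((1 / 2 : ℂ) + t' * I + u) / Complex.Gamma ((1 / 2 : ℂ) + t' * I)) /
        ((t : ℂ) * I - t' * I)) (re ⁻¹' Icc a b) := by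
  intro u hu
  have hu' : a ≤ u.re := by simpa using (show u.re ∈ Icc a b from hu).1
  have h1 := differentiableAt_gammaRatio (w := (1 / 2 : ℂ) + t * I) (u := u) (by simp; norm_num)
    (by linarith)
  have h2 := differentiableAt_gammaRatio (w := (1 / 2 : ℂ) + t' * I) (u := u) (by simp; norm_num)
    (by linarith)
  exact ((h1.sub h2).div_const _).differentiableWithinAt

/-- The divided difference vanishes at `u = 0` (both ratios equal `1` there): no residue in the
shift to `Re u = −1/4`. [cite: ConreyIwaniec2002, Lemma 7.4 (proof)] -/
theorem dd_gammaRatio_zero (t t' : ℝ) :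
    (fun u : ℂ ↦ (Complex.Gamma ((1 / 2 : ℂ) + t * I + u) / Complex.Gamma ((1 / 2 : ℂ) + t * I) -
        Complex.Gamma ((1 / 2 : ℂ) + t' * I + u) / Complex.Gamma ((1 / 2 : ℂ) + t' * I)) /
        ((t : ℂ) * I - t' * I)) 0 = 0 := by
  have h1 : Complex.Gamma ((1 / 2 : ℂ) + t * I) ≠ 0 :=
    Complex.Gamma_ne_zero_of_re_pos (by simp)
  have h2 : Complex.Gamma ((1 / 2 : ℂ) + t' * I) ≠ 0 :=
    Complex.Gamma_ne_zero_of_re_pos (by simp)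
  simp only [add_zero, div_self h1, div_self h2, sub_self, zero_div]

/-! ## Generic consequences for a numerator of Stirling class with scale `A` -/

/-- From line bounds with scale `A` to a uniform bound on a strip. [folklore] -/
private theorem strip_bound_of_line_bound {H : ℂ → ℂ} {M₀ A : ℝ} (hM₀ : 0 ≤ M₀) (hA : 0 < A)
    (hline : ∀ c : ℝ, -1 / 4 ≤ c → c ≤ 6 → ∀ v : ℝ,
      ‖H ((c : ℂ) + v * I)‖ ≤ M₀ * A ^ c * (1 + |v|) ^ 7 * Real.exp (π * |v| / 2))
    {a b : ℝ} (ha : -1 / 4 ≤ a) (hb : b ≤ 6) :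
    ∀ u : ℂ, a ≤ u.re → u.re ≤ b →
      ‖H u‖ ≤ M₀ * (A ^ a + A ^ b) * (1 + |u.im|) ^ 7 * Real.exp (π * |u.im| / 2) := by
  intro u hua hub
  have h := hline u.re (by linarith) (by linarith) u.im
  rw [Complex.re_add_im] at h
  have hpow : A ^ u.re ≤ A ^ a + A ^ b := by
    have ha0 : 0 ≤ A ^ a := Real.rpow_nonneg hA.le a
    have hb0 : 0 ≤ A ^ b := Real.rpow_nonneg hA.le b
    rcases le_or_gt 1 A with h1 | h1
    · have : A ^ u.re ≤ A ^ b := Real.rpow_le_rpow_of_exponent_le h1 hub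
      linarith
    · have : A ^ u.re ≤ A ^ a := Real.rpow_le_rpow_of_exponent_ge hA h1.le hua
      linarith
  refine h.trans ?_
  have : 0 ≤ (1 + |u.im|) ^ 7 * Real.exp (π * |u.im| / 2) := by positivity
  calc M₀ * A ^ u.re * (1 + |u.im|) ^ 7 * Real.exp (π * |u.im| / 2)
      = M₀ * A ^ u.re * ((1 + |u.im|) ^ 7 * Real.exp (π * |u.im| / 2)) := by ring
    _ ≤ M₀ * (A ^ a + A ^ b) * ((1 + |u.im|) ^ 7 * Real.exp (π * |u.im| / 2)) := by gcongr
    _ = _ := by ring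

/-- Continuity on the lines of the closed strip from holomorphy there. [folklore] -/
private theorem continuous_line_of_differentiableOn {H : ℂ → ℂ}
    (hdiff : DifferentiableOn ℂ H (re ⁻¹' Icc (-1 / 4) 6)) {c : ℝ} (hc1 : -1 / 4 ≤ c) (hc2 : c ≤ 6) :
    Continuous fun v : ℝ ↦ H ((c : ℂ) + v * I) := by
  have hl : Continuous fun v : ℝ ↦ (c : ℂ) + v * I := by fun_prop
  exact hdiff.continuousOn.comp_continuous hl fun v ↦ by simpa using And.intro hc1 hc2

/-- **The `k = 0` integrals**: both scale bounds for `∫ H(u)e^{u²}y^{-u} du` on `Re u = 1` for a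
holomorphic numerator of Stirling class with scale `A`. [cite: ConreyIwaniec2002, Lemma 7.2 (proof)] -/
theorem lineF_zero_bounds {H : ℂ → ℂ} {M₀ A y : ℝ} (hM₀ : 0 ≤ M₀) (hA : 0 < A) (hy : 0 < y)
    (hline : ∀ c : ℝ, -1 / 4 ≤ c → c ≤ 6 → ∀ v : ℝ,
      ‖H ((c : ℂ) + v * I)‖ ≤ M₀ * A ^ c * (1 + |v|) ^ 7 * Real.exp (π * |v| / 2))
    (hdiff : DifferentiableOn ℂ H (re ⁻¹' Icc (-1 / 4) 6)) :
    ‖∫ v : ℝ, H (((1 : ℝ) : ℂ) + v * I) * cexp ((((1 : ℝ) : ℂ) + v * I) ^ 2) *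
        (y : ℂ) ^ (-(((1 : ℝ) : ℂ) + v * I)) / (((1 : ℝ) : ℂ) + v * I) ^ 0‖ ≤
      M₀ * (Real.exp (6 ^ 2 + ((7 : ℝ) + 2) ^ 2 / 2) * Real.sqrt (2 * π)) * (A / y) ^ 6 ∧
    ‖∫ v : ℝ, H (((1 : ℝ) : ℂ) + v * I) * cexp ((((1 : ℝ) : ℂ) + v * I) ^ 2) *
        (y : ℂ) ^ (-(((1 : ℝ) : ℂ) + v * I)) / (((1 : ℝ) : ℂ) + v * I) ^ 0‖ ≤
      M₀ * (Real.exp ((-1 / 4) ^ 2 + ((7 : ℝ) + 2) ^ 2 / 2) * Real.sqrt (2 * π)) *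
        (y / A) ^ (1 / 4 : ℝ) := by
  constructor
  · rw [integral_lineF_eq_of_noPole (h := H) (a := 1) (b := 6) (k := 0) (n := 7) (by norm_num) hy
      (Or.inl rfl) (hdiff.mono (Set.preimage_mono (Set.Icc_subset_Icc (by norm_num) le_rfl)))
      (strip_bound_of_line_bound hM₀ hA hline (by norm_num) le_rfl)]
    have h := norm_integral_lineF_le (h := H) (k := 0) (n := 7) (c := 6) (M := M₀ * A ^ (6 : ℝ)) hy
      (Or.inl rfl) (hline 6 (by norm_num) le_rfl)
    refine h.trans (le_of_eq ?_)
    rw [← rpow_six_mul_rpow_neg_six (A := A) hy, pow_zero, div_one]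
    ring
  · rw [← integral_lineF_eq_of_noPole (h := H) (a := -1 / 4) (b := 1) (k := 0) (n := 7) (by norm_num)
      hy (Or.inl rfl) (hdiff.mono (Set.preimage_mono (Set.Icc_subset_Icc le_rfl (by norm_num))))
      (strip_bound_of_line_bound hM₀ hA hline le_rfl (by norm_num))]
    have h := norm_integral_lineF_le (h := H) (k := 0) (n := 7) (c := -1 / 4)
      (M := M₀ * A ^ (-1 / 4 : ℝ)) hy (Or.inl rfl) (hline (-1 / 4) le_rfl (by norm_num))
    refine h.trans (le_of_eq ?_)
    rw [← rpow_neg_quarter_mul hA hy.le, pow_zero, div_one,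
      show (-(-1 / 4 : ℝ)) = 1 / 4 by norm_num, show (-1 / 4 : ℝ) = -(1 / 4) by norm_num]
    ring

/-- **The `k = 1` integrals**: `‖∫ F₁(1+iv)‖ ≪ (A/y)^6` and `‖∫ F₁(1+iv) − 2π H(0)‖ ≪ (y/A)^{1/4}`
for a holomorphic numerator of Stirling class with scale `A` (residue `H(0)` at `u = 0`).
[cite: ConreyIwaniec2002, Lemma 7.2 (proof)] -/
theorem lineF_one_bounds {H : ℂ → ℂ} {M₀ A y : ℝ} (hM₀ : 0 ≤ M₀) (hA : 0 < A) (hy : 0 < y)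
    (hline : ∀ c : ℝ, -1 / 4 ≤ c → c ≤ 6 → ∀ v : ℝ,
      ‖H ((c : ℂ) + v * I)‖ ≤ M₀ * A ^ c * (1 + |v|) ^ 7 * Real.exp (π * |v| / 2))
    (hdiff : DifferentiableOn ℂ H (re ⁻¹' Icc (-1 / 4) 6)) :
    ‖∫ v : ℝ, H (((1 : ℝ) : ℂ) + v * I) * cexp ((((1 : ℝ) : ℂ) + v * I) ^ 2) *
        (y : ℂ) ^ (-(((1 : ℝ) : ℂ) + v * I)) / (((1 : ℝ) : ℂ) + v * I) ^ 1‖ ≤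
      M₀ * (Real.exp (6 ^ 2 + ((7 : ℝ) + 2) ^ 2 / 2) * Real.sqrt (2 * π) / 6) * (A / y) ^ 6 ∧
    ‖(∫ v : ℝ, H (((1 : ℝ) : ℂ) + v * I) * cexp ((((1 : ℝ) : ℂ) + v * I) ^ 2) *
        (y : ℂ) ^ (-(((1 : ℝ) : ℂ) + v * I)) / (((1 : ℝ) : ℂ) + v * I) ^ 1) - 2 * π * H 0‖ ≤
      M₀ * (Real.exp ((-1 / 4) ^ 2 + ((7 : ℝ) + 2) ^ 2 / 2) * Real.sqrt (2 * π) / (1 / 4)) *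
        (y / A) ^ (1 / 4 : ℝ) := by
  constructor
  · rw [integral_lineF_eq_of_noPole (h := H) (a := 1) (b := 6) (k := 1) (n := 7) (by norm_num) hy
      (Or.inr (Or.inr one_pos))
      (hdiff.mono (Set.preimage_mono (Set.Icc_subset_Icc (by norm_num) le_rfl)))
      (strip_bound_of_line_bound hM₀ hA hline (by norm_num) le_rfl)]
    have h := norm_integral_lineF_le (h := H) (k := 1) (n := 7) (c := 6) (M := M₀ * A ^ (6 : ℝ)) hy
      (Or.inr (by norm_num)) (hline 6 (by norm_num) le_rfl)
    refine h.trans (le_of_eq ?_)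
    rw [← rpow_six_mul_rpow_neg_six (A := A) hy, show |(6 : ℝ)| = 6 by norm_num]
    ring
  · have key := integral_lineF_one_sub_eq (h := H) (a := -1 / 4) (b := 1) (n := 7) (by norm_num)
      one_pos hy (hdiff.mono (Set.preimage_mono (Set.Icc_subset_Icc le_rfl (by norm_num))))
      (strip_bound_of_line_bound hM₀ hA hline le_rfl (by norm_num))
    have e : (∫ v : ℝ, H (((1 : ℝ) : ℂ) + v * I) * cexp ((((1 : ℝ) : ℂ) + v * I) ^ 2) *
        (y : ℂ) ^ (-(((1 : ℝ) : ℂ) + v * I)) / (((1 : ℝ) : ℂ) + v * I) ^ 1) - 2 * π * H 0 =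
        ∫ v : ℝ, H (((-1 / 4 : ℝ) : ℂ) + v * I) * cexp ((((-1 / 4 : ℝ) : ℂ) + v * I) ^ 2) *
          (y : ℂ) ^ (-(((-1 / 4 : ℝ) : ℂ) + v * I)) / (((-1 / 4 : ℝ) : ℂ) + v * I) := by
      simp only [pow_one]
      linear_combination key
    rw [e]
    have h := norm_integral_lineF_le (h := H) (k := 1) (n := 7) (c := -1 / 4)
      (M := M₀ * A ^ (-1 / 4 : ℝ)) hy (Or.inr (by norm_num)) (hline (-1 / 4) le_rfl (by norm_num))
    simp only [pow_one] at h
    refine h.trans (le_of_eq ?_)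
    rw [← rpow_neg_quarter_mul hA hy.le, show |(-1 / 4 : ℝ)| = 1 / 4 by norm_num,
      show (-(-1 / 4 : ℝ)) = 1 / 4 by norm_num, show (-1 / 4 : ℝ) = -(1 / 4) by norm_num]
    ring

/-! ## The divided differences of `V` and `y∂_yV` -/

/-- `|t′| ≥ 1` and hence `|Im s′| ≥ 1/2` for the companion. [folklore] -/
private theorem companion_im {t t' : ℝ} (ht : 2 ≤ |t|) (hclose : |t' - t| ≤ 1) : 1 / 2 ≤ |t'| := by
  have := abs_sub_abs_le_abs_sub t t'
  rw [abs_sub_comm] at this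
  linarith

/-- **The divided difference of `V` is the line integral of the divided-difference numerator**:
`(V(s,y) − V(s′,y))/(s − s′) = (1/2π) ∫ F₁[H_{s,s′}](1+iv) dv`.
[cite: ConreyIwaniec2002, Lemma 7.4 (proof, v_s as an integral)] -/
theorem dd_afeV_eq_lineF {t t' : ℝ} (ht : 2 ≤ |t|) (hclose : |t' - t| ≤ 1) {y : ℝ} (hy : 0 < y) :
    (afeV (1 / 2 + t * I) y - afeV (1 / 2 + t' * I) y) / ((t : ℂ) * I - t' * I) =
      (1 / (2 * Real.pi) : ℂ) * ∫ v : ℝ,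
        (fun u : ℂ ↦ (Complex.Gamma ((1 / 2 : ℂ) + t * I + u) / Complex.Gamma ((1 / 2 : ℂ) + t * I) -
          Complex.Gamma ((1 / 2 : ℂ) + t' * I + u) / Complex.Gamma ((1 / 2 : ℂ) + t' * I)) /
          ((t : ℂ) * I - t' * I)) (((1 : ℝ) : ℂ) + v * I) *
        cexp ((((1 : ℝ) : ℂ) + v * I) ^ 2) * (y : ℂ) ^ (-(((1 : ℝ) : ℂ) + v * I)) /
          (((1 : ℝ) : ℂ) + v * I) ^ 1 := by
  obtain ⟨C, hC, hb⟩ := exists_norm_Gamma_add_div_le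
  have ht' := companion_im ht hclose
  have hint : ∀ τ : ℝ, 1 / 2 ≤ |τ| → Integrable fun v : ℝ ↦
      (fun u : ℂ ↦ Complex.Gamma ((1 / 2 : ℂ) + τ * I + u) / Complex.Gamma ((1 / 2 : ℂ) + τ * I))
        (((1 : ℝ) : ℂ) + v * I) * cexp ((((1 : ℝ) : ℂ) + v * I) ^ 2) *
        (y : ℂ) ^ (-(((1 : ℝ) : ℂ) + v * I)) / (((1 : ℝ) : ℂ) + v * I) ^ 1 := by
    intro τ hτ
    have hw1 : 3 / 8 ≤ ((1 / 2 : ℂ) + τ * I).re := by simp; norm_num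
    have hw2 : ((1 / 2 : ℂ) + τ * I).re ≤ 5 / 8 := by simp; norm_num
    have hwi : 1 / 2 ≤ |((1 / 2 : ℂ) + τ * I).im| := by simpa using hτ
    exact integrable_lineF
      (h := fun u : ℂ ↦ Complex.Gamma ((1 / 2 : ℂ) + τ * I + u) / Complex.Gamma ((1 / 2 : ℂ) + τ * I))
      (c := 1) (k := 1) (n := 7) (M := C * ‖(1 / 2 : ℂ) + τ * I‖ ^ (1 : ℝ)) hy (Or.inr one_ne_zero)
      (continuous_gammaRatio_line hw1 (by norm_num))
      (gammaRatio_line_bound hb hw1 hw2 hwi (by norm_num) (by norm_num))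
  have h1 := hint t (by linarith)
  have h2 := hint t' ht'
  rw [afeV_eq_lineF, afeV_eq_lineF, ← mul_sub, ← integral_sub h1 h2, mul_div_assoc, ← integral_div]
  congr 1
  refine integral_congr_ae (Filter.Eventually.of_forall fun v ↦ ?_)
  simp only
  ring

/-- **The divided difference of `y∂_yV`** as the `k = 0` line integral of the divided-difference
numerator: `y(∂_yV(s,y) − ∂_yV(s′,y))/(s − s′) = −(1/2π)∫ F₀[H_{s,s′}](1+iv) dv`.
[cite: ConreyIwaniec2002, Lemma 7.4 (proof, derivatives of v_s)] -/
theorem dd_deriv_afeV_eq_lineF {t t' : ℝ} (ht : 2 ≤ |t|) (hclose : |t' - t| ≤ 1) {y : ℝ}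
    (hy : 0 < y) :
    (y : ℂ) * (deriv (afeV (1 / 2 + t * I)) y - deriv (afeV (1 / 2 + t' * I)) y) /
        ((t : ℂ) * I - t' * I) =
      -(1 / (2 * Real.pi) : ℂ) * ∫ v : ℝ,
        (fun u : ℂ ↦ (Complex.Gamma ((1 / 2 : ℂ) + t * I + u) / Complex.Gamma ((1 / 2 : ℂ) + t * I) -
          Complex.Gamma ((1 / 2 : ℂ) + t' * I + u) / Complex.Gamma ((1 / 2 : ℂ) + t' * I)) /
          ((t : ℂ) * I - t' * I)) (((1 : ℝ) : ℂ) + v * I) *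
        cexp ((((1 : ℝ) : ℂ) + v * I) ^ 2) * (y : ℂ) ^ (-(((1 : ℝ) : ℂ) + v * I)) /
          (((1 : ℝ) : ℂ) + v * I) ^ 0 := by
  obtain ⟨C, hC, hb⟩ := exists_norm_Gamma_add_div_le
  have ht' := companion_im ht hclose
  have hint : ∀ τ : ℝ, 1 / 2 ≤ |τ| → Integrable fun v : ℝ ↦
      (fun u : ℂ ↦ Complex.Gamma ((1 / 2 : ℂ) + τ * I + u) / Complex.Gamma ((1 / 2 : ℂ) + τ * I))
        (((1 : ℝ) : ℂ) + v * I) * cexp ((((1 : ℝ) : ℂ) + v * I) ^ 2) *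
        (y : ℂ) ^ (-(((1 : ℝ) : ℂ) + v * I)) / (((1 : ℝ) : ℂ) + v * I) ^ 0 := by
    intro τ hτ
    have hw1 : 3 / 8 ≤ ((1 / 2 : ℂ) + τ * I).re := by simp; norm_num
    have hw2 : ((1 / 2 : ℂ) + τ * I).re ≤ 5 / 8 := by simp; norm_num
    have hwi : 1 / 2 ≤ |((1 / 2 : ℂ) + τ * I).im| := by simpa using hτ
    exact integrable_lineF
      (h := fun u : ℂ ↦ Complex.Gamma ((1 / 2 : ℂ) + τ * I + u) / Complex.Gamma ((1 / 2 : ℂ) + τ * I))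
      (c := 1) (k := 0) (n := 7) (M := C * ‖(1 / 2 : ℂ) + τ * I‖ ^ (1 : ℝ)) hy (Or.inl rfl)
      (continuous_gammaRatio_line hw1 (by norm_num))
      (gammaRatio_line_bound hb hw1 hw2 hwi (by norm_num) (by norm_num))
  obtain ⟨D, hD, hyD⟩ := hasDerivAt_afeV (w := (1 / 2 : ℂ) + t * I) (by simp; norm_num)
    (by simp; norm_num) (by simp; linarith) hy
  obtain ⟨D', hD', hyD'⟩ := hasDerivAt_afeV (w := (1 / 2 : ℂ) + t' * I) (by simp; norm_num)
    (by simp; norm_num) (by simpa using ht') hy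
  rw [hD.deriv, hD'.deriv, mul_sub, hyD, hyD', ← mul_sub, ← integral_sub (hint t (by linarith))
    (hint t' ht'), mul_div_assoc, ← integral_div]
  congr 1
  refine integral_congr_ae (Filter.Eventually.of_forall fun v ↦ ?_)
  simp only
  ring

/-- **Lemma 7.4 (the part used in §8): the divided differences of `V` and `y∂_yV` along the
critical line are `≪ (1 + y/‖s‖)^{-6}`** (`|t| ≥ 2`, `0 < |t − t′| ≤ 1`).
[cite: ConreyIwaniec2002, Lemma 7.4 (7.25)] -/
theorem dd_afeV_bounds :
    ∃ K : ℝ, 0 < K ∧ ∀ (t t' y : ℝ), 2 ≤ |t| → t' ≠ t → |t' - t| ≤ 1 → 0 < y →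
      ‖(afeV (1 / 2 + t * I) y - afeV (1 / 2 + t' * I) y) / ((t : ℂ) * I - t' * I)‖ ≤
          K * ((1 + y / ‖(1 / 2 : ℂ) + t * I‖) ^ 6)⁻¹ ∧
      ‖(y : ℂ) * (deriv (afeV (1 / 2 + t * I)) y - deriv (afeV (1 / 2 + t' * I)) y) /
          ((t : ℂ) * I - t' * I)‖ ≤ K * ((1 + y / ‖(1 / 2 : ℂ) + t * I‖) ^ 6)⁻¹ := by
  obtain ⟨C, hC, hb⟩ := exists_norm_Gamma_add_div_le
  set K₆ : ℝ := 1 / (2 * Real.pi) * (120 * C * (Real.exp (6 ^ 2 + ((7 : ℝ) + 2) ^ 2 / 2) *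
    Real.sqrt (2 * π) / 6)) with hK₆
  set K₁ : ℝ := 1 / (2 * Real.pi) * (120 * C * (Real.exp ((-1 / 4) ^ 2 + ((7 : ℝ) + 2) ^ 2 / 2) *
    Real.sqrt (2 * π) / (1 / 4))) with hK₁
  set L₆ : ℝ := 1 / (2 * Real.pi) * (120 * C * (Real.exp (6 ^ 2 + ((7 : ℝ) + 2) ^ 2 / 2) *
    Real.sqrt (2 * π))) with hL₆
  set L₁ : ℝ := 1 / (2 * Real.pi) * (120 * C * (Real.exp ((-1 / 4) ^ 2 + ((7 : ℝ) + 2) ^ 2 / 2) *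
    Real.sqrt (2 * π))) with hL₁
  have hK₆0 : 0 < K₆ := by positivity
  have hK₁0 : 0 < K₁ := by positivity
  have hL₆0 : 0 < L₆ := by positivity
  have hL₁0 : 0 < L₁ := by positivity
  refine ⟨64 * (K₁ + K₆) + 64 * (L₁ + L₆), by positivity, fun t t' y ht htt' hclose hy ↦ ?_⟩
  have hs0 : 0 < ‖(1 / 2 : ℂ) + t * I‖ := by
    have h := Complex.abs_im_le_norm ((1 / 2 : ℂ) + t * I)
    have e : ((1 / 2 : ℂ) + t * I).im = t := by simp
    rw [e] at h
    linarith
  -- the divided-difference numerator: Stirling class with scale `‖s‖`, holomorphic, vanishing at 0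
  have hline := fun c (hc1 : -1 / 4 ≤ c) (hc2 : c ≤ 6) (v : ℝ) ↦
    dd_gammaRatio_line_bound hC.le hb ht htt' hclose hc1 hc2 v
  have hdiff := differentiableOn_dd_gammaRatio t t' (a := -1 / 4) (b := 6) le_rfl
  have hzero := dd_gammaRatio_zero t t'
  have hM₀ : (0 : ℝ) ≤ 120 * C := by positivity
  obtain ⟨h1large, h1small⟩ := lineF_one_bounds hM₀ hs0 hy hline hdiff
  obtain ⟨h0large, h0small⟩ := lineF_zero_bounds hM₀ hs0 hy hline hdiff
  have hzero' : (Complex.Gamma ((1 / 2 : ℂ) + t * I + 0) / Complex.Gamma ((1 / 2 : ℂ) + t * I) -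
      Complex.Gamma ((1 / 2 : ℂ) + t' * I + 0) / Complex.Gamma ((1 / 2 : ℂ) + t' * I)) /
      ((t : ℂ) * I - t' * I) = 0 := hzero
  rw [hzero', mul_zero, sub_zero] at h1small
  have hr0 : 0 ≤ y / ‖(1 / 2 : ℂ) + t * I‖ := by positivity
  have hsmall : y ≤ ‖(1 / 2 : ℂ) + t * I‖ → (y / ‖(1 / 2 : ℂ) + t * I‖) ^ (1 / 4 : ℝ) ≤ 1 :=
    fun hyw ↦ Real.rpow_le_one hr0 ((div_le_one hs0).2 hyw) (by norm_num)
  have hinv0 : 0 ≤ ((1 + y / ‖(1 / 2 : ℂ) + t * I‖) ^ 6)⁻¹ := by positivity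
  constructor
  · rw [dd_afeV_eq_lineF ht hclose hy, norm_mul, norm_inv_two_pi]
    refine (le_inv_one_add_pow_six hs0 hy hK₁0.le hK₆0.le (fun hyw ↦ ?_) (fun _ ↦ ?_)).trans ?_
    · calc _ ≤ 1 / (2 * Real.pi) * (120 * C *
            (Real.exp ((-1 / 4) ^ 2 + ((7 : ℝ) + 2) ^ 2 / 2) * Real.sqrt (2 * π) / (1 / 4)) *
            (y / ‖(1 / 2 : ℂ) + t * I‖) ^ (1 / 4 : ℝ)) :=
            mul_le_mul_of_nonneg_left h1small (by positivity)
        _ = K₁ * (y / ‖(1 / 2 : ℂ) + t * I‖) ^ (1 / 4 : ℝ) := by rw [hK₁]; ring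
        _ ≤ K₁ * 1 := by gcongr; exact hsmall hyw
        _ = K₁ := mul_one _
    · calc _ ≤ 1 / (2 * Real.pi) * (120 * C *
            (Real.exp (6 ^ 2 + ((7 : ℝ) + 2) ^ 2 / 2) * Real.sqrt (2 * π) / 6) *
            (‖(1 / 2 : ℂ) + t * I‖ / y) ^ 6) :=
            mul_le_mul_of_nonneg_left h1large (by positivity)
        _ = K₆ * (‖(1 / 2 : ℂ) + t * I‖ / y) ^ 6 := by rw [hK₆]; ring
    · gcongr
      linarith [mul_nonneg (by norm_num : (0 : ℝ) ≤ 64) (add_nonneg hL₁0.le hL₆0.le)]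
  · rw [dd_deriv_afeV_eq_lineF ht hclose hy, norm_mul, norm_neg, norm_inv_two_pi]
    refine (le_inv_one_add_pow_six hs0 hy hL₁0.le hL₆0.le (fun hyw ↦ ?_) (fun _ ↦ ?_)).trans ?_
    · calc _ ≤ 1 / (2 * Real.pi) * (120 * C *
            (Real.exp ((-1 / 4) ^ 2 + ((7 : ℝ) + 2) ^ 2 / 2) * Real.sqrt (2 * π)) *
            (y / ‖(1 / 2 : ℂ) + t * I‖) ^ (1 / 4 : ℝ)) :=
            mul_le_mul_of_nonneg_left h0small (by positivity)
        _ = L₁ * (y / ‖(1 / 2 : ℂ) + t * I‖) ^ (1 / 4 : ℝ) := by rw [hL₁]; ring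
        _ ≤ L₁ * 1 := by gcongr; exact hsmall hyw
        _ = L₁ := mul_one _
    · calc _ ≤ 1 / (2 * Real.pi) * (120 * C *
            (Real.exp (6 ^ 2 + ((7 : ℝ) + 2) ^ 2 / 2) * Real.sqrt (2 * π)) *
            (‖(1 / 2 : ℂ) + t * I‖ / y) ^ 6) :=
            mul_le_mul_of_nonneg_left h0large (by positivity)
        _ = L₆ * (‖(1 / 2 : ℂ) + t * I‖ / y) ^ 6 := by rw [hL₆]; ring
    · gcongr
      linarith [mul_nonneg (by norm_num : (0 : ℝ) ≤ 64) (add_nonneg hK₁0.le hK₆0.le)]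

end AFEKernel

open AFEKernel in
/-- **Conrey–Iwaniec (2002), Lemma 7.2 and Lemma 7.4 (the part used in §8), for the kernel
`V_s(y)` of the approximate functional equation with test function `G(u) = e^{u²}`** — the
registered stub S2 `stub_afeV_bounds` of the fact skeleton `prop81-afe-plancherel` (cell
landau-siegel / ls-inputs, Proposition 8.1 line), VERBATIM. With one absolute constant `C`:
on the strip `3/8 ≤ Re w ≤ 5/8`, `|Im w| ≥ 1`, for `y > 0`,
(a) `‖V(w,y)‖ ≤ C(1 + y/‖w‖)^{−6}` ((7.16) with `A = 6`), (b) `‖V(w,y) − 1‖ ≤ C(y/‖w‖)^{1/4}`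
((7.17)), (c) `V(w,·)` is differentiable at `y` with `‖y∂_yV(w,y)‖ ≤ C(1+y/‖w‖)^{−6}` and
`≤ C(y/‖w‖)^{1/4}`; and (d) on the critical line, for `|t| ≥ 2`, `0 < |t − t′| ≤ 1`, the divided
differences `(V(s,y) − V(s′,y))/(s − s′)` and `y(∂_yV(s,y) − ∂_yV(s′,y))/(s − s′)`
(`s = ½+it`, `s′ = ½+it′`) are `≤ C(1 + y/‖s‖)^{−6}` ((7.25) for close companions).
Proof: `afeV_strip_bounds` (contour shifts `Re u = 1 → 6` and `→ −1/4` across the simple pole at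
`u = 0`, Stirling for `Γ(w+u)/Γ(w)`, differentiation under the integral sign) and `dd_afeV_bounds`
(Cauchy's estimate in `w`, no residue for the divided difference).
[cite: ConreyIwaniec2002, Lemma 7.2 (7.16)–(7.17), Lemma 7.4 (7.25)] -/
theorem afeV_bounds :
    ∃ C : ℝ, 0 < C ∧
      (∀ (w : ℂ) (y : ℝ), 3 / 8 ≤ w.re → w.re ≤ 5 / 8 → 1 ≤ |w.im| → 0 < y →
        ‖afeV w y‖ ≤ C * ((1 + y / ‖w‖) ^ 6)⁻¹ ∧
        ‖afeV w y - 1‖ ≤ C * (y / ‖w‖) ^ ((1 : ℝ) / 4) ∧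
        DifferentiableAt ℝ (afeV w) y ∧
        ‖(y : ℂ) * deriv (afeV w) y‖ ≤ C * ((1 + y / ‖w‖) ^ 6)⁻¹ ∧
        ‖(y : ℂ) * deriv (afeV w) y‖ ≤ C * (y / ‖w‖) ^ ((1 : ℝ) / 4)) ∧
      (∀ (t t' y : ℝ), 2 ≤ |t| → t' ≠ t → |t' - t| ≤ 1 → 0 < y →
        ‖(afeV (1 / 2 + t * I) y - afeV (1 / 2 + t' * I) y) / ((t : ℂ) * I - t' * I)‖ ≤
            C * ((1 + y / ‖(1 / 2 : ℂ) + t * I‖) ^ 6)⁻¹ ∧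
        ‖(y : ℂ) * (deriv (afeV (1 / 2 + t * I)) y - deriv (afeV (1 / 2 + t' * I)) y) /
            ((t : ℂ) * I - t' * I)‖ ≤ C * ((1 + y / ‖(1 / 2 : ℂ) + t * I‖) ^ 6)⁻¹) := by
  obtain ⟨K, hK, hstrip⟩ := afeV_strip_bounds
  obtain ⟨K', hK', hdd⟩ := dd_afeV_bounds
  refine ⟨K + K', by positivity, ?_, ?_⟩
  · intro w y hw1 hw2 hwi hy
    obtain ⟨h1, h2, h3, h4, h5⟩ := hstrip w y hw1 hw2 (by linarith) hy
    have hw0 : 0 < ‖w‖ := by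
      have := Complex.abs_im_le_norm w; linarith
    have hA : 0 ≤ ((1 + y / ‖w‖) ^ 6)⁻¹ := by positivity
    have hB : 0 ≤ (y / ‖w‖) ^ ((1 : ℝ) / 4) := Real.rpow_nonneg (by positivity) _
    have hKA : K * ((1 + y / ‖w‖) ^ 6)⁻¹ ≤ (K + K') * ((1 + y / ‖w‖) ^ 6)⁻¹ :=
      mul_le_mul_of_nonneg_right (by linarith) hA
    have hKB : K * (y / ‖w‖) ^ ((1 : ℝ) / 4) ≤ (K + K') * (y / ‖w‖) ^ ((1 : ℝ) / 4) :=
      mul_le_mul_of_nonneg_right (by linarith) hB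
    exact ⟨h1.trans hKA, h2.trans hKB, h3, h4.trans hKA, h5.trans hKB⟩
  · intro t t' y ht htt' hclose hy
    obtain ⟨h1, h2⟩ := hdd t t' y ht htt' hclose hy
    have hA : 0 ≤ ((1 + y / ‖(1 / 2 : ℂ) + t * I‖) ^ 6)⁻¹ := by positivity
    have hKA : K' * ((1 + y / ‖(1 / 2 : ℂ) + t * I‖) ^ 6)⁻¹ ≤
        (K + K') * ((1 + y / ‖(1 / 2 : ℂ) + t * I‖) ^ 6)⁻¹ :=
      mul_le_mul_of_nonneg_right (by linarith) hA
    exact ⟨h1.trans hKA, h2.trans hKA⟩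

end ConreyIwaniec2002

end Literature.NumberTheory.LFunctions

end
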